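import Mathlib
import HarnessLib
import Literature.Probability.MarkovChains.MarkovChainDecomposition
import Literature.Probability.MarkovChains.DensityDecomposition

/-!
# Simulated tempering and state decomposition (Madras–Randall, Ann. Appl. Probab. 12 (2002), §2, §4 and
# Appendix A): the Caracciolo–Pelissetto–Sokal bound `Gap(QPQ) ≥ Gap(Q̄)·min Gap(P_i)` and the
# STATE DECOMPOSITION THEOREM 1.1 `Gap(P) ≥ Θ⁻¹·Gap(P_H)·min{1, min_i Gap(P[A_i])}`

HONEST FRAMING: exact (Metropolis-corrected) sampling algorithms for lattice gauge theory; figures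
of merit are autocorrelation/cost numbers at stated couplings and volumes; no continuum-physics claim.

THREE PARTS, in the order of the paper's proof of Theorem 1.1 [cite: MadrasRandall2002, §4 eq. (39)]:
PART A (namespace `…MarkovChains.Decomposition`, the vocabulary of `MarkovChainDecomposition.lean`) —
Appendix A THEOREM A.1 (Caracciolo–Pelissetto–Sokal) in the projection case `Q² = Q`, i.e. §2 THEOREM 2.1,
for an abstract finite `𝒮` with pieces; PART B (namespace `…MarkovChains.DensityDecomposition`, the
vocabulary of `DensityDecomposition.lean`: `mhKernel`, `pieceLaw`, `coverMixture`, `temperingChain`, …) —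
§4 eqs. (32)–(38): the pieces `T_i` versus `P[A_i]`, the crude chain `P_H` (5) versus the aggregated
matrix `Q̄` (19)/(36); PART C — the identification of Theorem A.1's objects on `𝒮 = Ω × {0,…,D}` with the
simulated tempering chain of §2, THEOREM 2.1 for that chain, and THEOREM 1.1.  Each part carries its own
module-style docstring below.  Source READ: [MadrasRandall2002] §§1–4, Appendices A–B (the hub literature
service's open-access copy).  Everything is PROVED (finite sums; 0 named facts).
-/

/-! # PART A — the Caracciolo–Pelissetto–Sokal bound for simulated tempering (Theorem 2.1 /
# Appendix A Theorem A.1 in the projection case `Q² = Q`): `Gap(QPQ) ≥ Gap(Q̄) · min_i Gap(P_i)`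

Conventions of `MarkovChainDecomposition.lean` (namespace `…MarkovChains.Decomposition`): finite
state space `X` (the paper's `𝒮`), probability vector `π ≥ 0` (the paper's `ψ`; it may vanish, as the
tempering measure `ψ(x,i) = c_iφ_i(x)` does off the supports of the `φ_i`), a partition into pieces
`𝒮_i = block blk i` given by `blk : X → I`, each of positive `ψ`-mass, `blockMass π blk = b` (`b_i = ψ(𝒮_i)`,
eq. (59)), `blockLaw π blk i = ψ_i` (59), `restrictionChain P blk = P̂` (eqs. (57)–(58): jumps leaving a
piece are rejected), `projectionChain π Q blk = Q̄` (eq. (62): `Q̄(i,j) = b_i⁻¹ Σ_{x∈𝒮_i, y∈𝒮_j}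
ψ(x)Q(x,y)`), `blockAvg π blk f = Π̂f` read on the pieces (61), `dirichletForm π P f = (f,(I−P)f)_ψ`
(`dirichletForm_eq`), `lawVariance π f = (f,(I−Π)f)_ψ`, `spectralGapR` = the variational gap (53)–(55).
Source READ: N. Madras, D. Randall, *Markov chain decomposition for convergence rate analysis*,
Ann. Appl. Probab. 12 (2002) 581–606 [MadrasRandall2002], §2 (Theorem 2.1) and Appendix A (Theorem
A.1 and its proof, eqs. (49)–(70), "due to Caracciolo, Pelissetto and Sokal (1992) … their proof, with
only editorial changes").  Everything is PROVED (finite sums; 0 named facts).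

THE CASE TREATED.  Theorem A.1 assumes `Q` nonnegative definite and bounds `Gap(Q^{1/2}PQ^{1/2})`;
Theorem 2.1 (simulated tempering) is the case `Q² = Q` ("we observed in Section 2 that `Q` is reversible
and `Q² = Q`, so … `Q^{1/2} = Q`"), where the chain is `QPQ`.  This file types exactly that case, for
ANY finite `𝒮`, partition, `ψ`-reversible stochastic `P` and `ψ`-reversible stochastic idempotent `Q`
(so it covers Theorem 2.1, whose `𝒮 = Ω × {1,…,m}`, `𝒮_i = Ω × {i}`, `P = ⊕ T_i`, and `Q` = label
resampling — the special case whose pieces are the label classes).  NOT typed: operator square roots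
(the general nonnegative-definite `Q` of Theorem A.1), and Lemma A.2 / Corollary A.3 (`Spec(AB) ∖ {0} =
Spec(BA) ∖ {0}`), which are replaced here by a two-line Cauchy–Schwarz argument giving directly the
inequality (70′) `(f, QΠ̂Qf)_ψ ≤ (1 − Gap(Q̄))(f,f)_ψ` for `ψ`-centred `f` — all that the proof uses.

THE PROOF [cite: MadrasRandall2002, Appendix A, proof of Theorem A.1]:
* (65)–(67) `dirichletForm_ge_blocks`: `(g,(I−P)g)_ψ ≥ (g,(I−P̂)g)_ψ = Σ_i b_i(g,(I−P_i)g)_{ψ_i} ≥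
  G⋆ Σ_i b_i Var_{ψ_i}(g) = G⋆ (g,(I−Π̂)g)_ψ` (the tree's eqs. (4)–(5) of Jerrum–Son–Tetali–Vigoda);
* `dirichletForm_QPQ_eq`: `(f,(I−QPQ)f)_ψ = (f,(I−Q)f)_ψ + (Qf,(I−P)Qf)_ψ` (first display of p. 604);
* (68)–(70), replaced: `piInner_blockAvg_sq_le` — for `ψ`-centred `f` and `h = Π̂Qf`,
  `‖h‖² = (Qh̃, f)_ψ ≤ ‖Qh̃‖‖f‖` and `‖Qh̃‖² = (h, Q̄h)_b ≤ (1 − Gap(Q̄))‖h‖²`, whence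
  `‖Π̂Qf‖² ≤ (1 − Gap(Q̄))‖f‖²`;
* assembly `CaraccioloPelissettoSokal_poincare` (Poincaré form, constants `G⋆ ≤ 1`, `Ḡ ≤ 1`):
  `(f,(I−QPQ)f)_ψ ≥ (1−G⋆)(f,(I−Q)f)_ψ + G⋆(f,(I−QΠ̂Q)f)_ψ ≥ G⋆Ḡ·Var_ψ(f)`, and the gap form
  **`MadrasRandall2002_thm_A_1_projection`**: `Gap_R(ψ, QPQ) ≥ Gap_R(b, Q̄) · min{1, min_i Gap_R(ψ_i, P_i)}`
  (the printed (64)/(20) reads `Gap(Q̄) min_i Gap(P_i)`; the proof's step "(1 − G⋆)(f,(I−Q)f) ≥ 0"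
  uses `G⋆ ≤ 1`, which is where the `min{1, ·}` comes from — for the lazy or Metropolis pieces of the
  applications `Gap(P_i) ≤ 1` anyway), and `MadrasRandall2002_thm_A_1_projection_spectralGap` (the same
  with `Gap = 1 − λ₂` for `QPQ` and `Q̄`, eq. (55), by the tree's Lemma 13.7; `QPQ` is `ψ`-reversible).
Context (cell pub-lqcd): simulated / parallel tempering across couplings is the standard remedy for
topological freezing; this is the lower bound "tempering is no slower than the label walk times the
slowest piece", complementing the upper bounds by bottleneck ratios already in the tree.
-/

namespace Literature.Probability.MarkovChains.Decomposition

open Finset Matrix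

variable {X I : Type*} [Fintype X] [DecidableEq X] [Fintype I] [DecidableEq I]

/-! ## Products of stochastic, stationary kernels; block lifts -/

omit [DecidableEq X] in
/-- `(M v)_x = Σ_y M x y v_y`. [folklore] -/
private theorem mulVec_apply_sum (M : Matrix X X ℝ) (v : X → ℝ) (x : X) :
    (M *ᵥ v) x = ∑ y, M x y * v y := rfl

omit [DecidableEq X] in
/-- `(AB)(x,y) = Σ_z A(x,z)B(z,y)`. [folklore] -/
private theorem mul_apply_sum (A B : Matrix X X ℝ) (x y : X) :
    (A * B) x y = ∑ z, A x z * B z y := Matrix.mul_apply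

omit [DecidableEq X] in
/-- The product of row-stochastic matrices is row-stochastic. [cite: MadrasRandall2002, §2 ("the
Markov chain corresponding to `QP` or to `PQ`, or to `QPQ`")] -/
theorem isRowStochastic_mul {A B : Matrix X X ℝ} (hA : IsRowStochastic A) (hB : IsRowStochastic B) :
    IsRowStochastic (A * B) := by
  refine ⟨fun x y => ?_, fun x => ?_⟩
  · rw [mul_apply_sum]
    exact sum_nonneg fun z _ => mul_nonneg (hA.1 x z) (hB.1 z y)
  · calc ∑ y, (A * B) x y = ∑ y, ∑ z, A x z * B z y := sum_congr rfl fun y _ => mul_apply_sum A B x y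
      _ = ∑ z, ∑ y, A x z * B z y := sum_comm
      _ = ∑ z, A x z := sum_congr rfl fun z _ => by rw [← mul_sum, hB.2 z, mul_one]
      _ = 1 := hA.2 x

omit [DecidableEq X] in
/-- Stationarity is preserved by products. [cite: MadrasRandall2002, §2 ("`QPQ` … is reversible with
respect to `ψ` (it inherits this property from `Q` and `P`)")] -/
theorem isStationary_mul {π : X → ℝ} {A B : Matrix X X ℝ} (hA : IsStationary π A)
    (hB : IsStationary π B) : IsStationary π (A * B) := by
  intro y
  calc ∑ x, π x * (A * B) x y = ∑ x, ∑ z, π x * A x z * B z y := by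
        refine sum_congr rfl fun x _ => ?_
        rw [mul_apply_sum, mul_sum]
        exact sum_congr rfl fun z _ => by ring
    _ = ∑ z, ∑ x, π x * A x z * B z y := sum_comm
    _ = ∑ z, π z * B z y := sum_congr rfl fun z _ => by rw [← sum_mul, hA z]
    _ = π y := hB y

omit [Fintype X] [DecidableEq X] [Fintype I] [DecidableEq I] in
/-- The lift `ṽ(x) = v(i)` for `x ∈ 𝒮_i` of a function on the pieces (the paper's identification of
`V_𝒮` = functions constant on each piece with functions on `{1,…,m}`).
[cite: MadrasRandall2002, Appendix A (the space `V_𝒮` before eq. (62))] -/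
def blockLift (blk : X → I) (v : I → ℝ) (x : X) : ℝ := v (blk x)

omit [DecidableEq X] in
/-- `(ṽ, g)_ψ = (v, Π̂g)_b`: pairing a lifted function with `g` only sees the block averages of `g`.
[cite: MadrasRandall2002, Appendix A eq. (61) and observation (i) `ψ = Σ b_iψ_i`] -/
theorem piInner_blockLift_left {π : X → ℝ} {blk : X → I} (hM : ∀ i, blockMass π blk i ≠ 0)
    (v : I → ℝ) (g : X → ℝ) :
    piInner π (blockLift blk v) g = piInner (blockMass π blk) v (blockAvg π blk g) := by
  unfold piInner blockLift
  rw [sum_eq_sum_block blk]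
  refine sum_congr rfl fun i _ => ?_
  rw [blockAvg_eq, mul_comm (blockMass π blk i), mul_assoc, div_mul_cancel₀ _ (hM i), mul_sum]
  refine sum_congr rfl fun x hx => ?_
  rw [mem_block.mp hx]
  ring

omit [DecidableEq X] in
/-- `(ṽ, Qw̃)_ψ = (v, Q̄w)_b`: on lifted functions `Q` acts as the aggregated matrix `Q̄` ("the
restriction of the operator `Π̂QΠ̂` to the `m`-dimensional vector space `V_𝒮` corresponds to the
matrix `Q̄`"). [cite: MadrasRandall2002, Appendix A eq. (62) and the sentence before eq. (69)] -/
theorem piInner_blockLift_mulVec_blockLift {π : X → ℝ} {blk : X → I}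
    (hM : ∀ i, blockMass π blk i ≠ 0) (Q : Matrix X X ℝ) (v w : I → ℝ) :
    piInner π (blockLift blk v) (Q *ᵥ blockLift blk w)
      = piInner (blockMass π blk) v (projectionChain π Q blk *ᵥ w) := by
  unfold piInner blockLift
  simp only [mulVec_apply_sum]
  rw [sum_eq_sum_block blk]
  refine sum_congr rfl fun i _ => ?_
  -- right side: `b_i v_i Σ_j Q̄_ij w_j = v_i Σ_j F_ij w_j`, `F_ij = Σ_{x∈𝒮_i,y∈𝒮_j} ψ(x)Q(x,y)`
  have hR : blockMass π blk i * (v i * ∑ j, projectionChain π Q blk i j * w j)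
      = v i * ∑ j, blockFlow π Q blk i j * w j := by
    calc blockMass π blk i * (v i * ∑ j, projectionChain π Q blk i j * w j)
        = v i * ∑ j, blockMass π blk i * (projectionChain π Q blk i j * w j) := by
          rw [← mul_sum]
          ring
      _ = v i * ∑ j, blockFlow π Q blk i j * w j := by
          refine congrArg _ (sum_congr rfl fun j _ => ?_)
          rw [← mul_assoc, blockMass_mul_projectionChain (hM i)]
  rw [hR]
  -- left side: `Σ_{x∈𝒮_i} ψ(x) v_i Σ_y Q(x,y) w(blk y)`; split `Σ_y` into blocks
  unfold blockFlow
  calc ∑ x ∈ block blk i, π x * (v (blk x) * ∑ y, Q x y * w (blk y))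
      = ∑ x ∈ block blk i, v i * ∑ j, ∑ y ∈ block blk j, π x * Q x y * w j := by
        refine sum_congr rfl fun x hx => ?_
        have hsplit : ∑ y, Q x y * w (blk y) = ∑ j, ∑ y ∈ block blk j, Q x y * w j := by
          rw [sum_eq_sum_block blk]
          exact sum_congr rfl fun j _ => sum_congr rfl fun y hy => by rw [mem_block.mp hy]
        rw [mem_block.mp hx, hsplit, mul_left_comm, mul_sum (s := (univ : Finset I))]
        refine congrArg _ (sum_congr rfl fun j _ => ?_)
        rw [mul_sum]
        exact sum_congr rfl fun y _ => by ring
    _ = v i * ∑ j, (∑ x ∈ block blk i, ∑ y ∈ block blk j, π x * Q x y) * w j := by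
        rw [← mul_sum]
        congr 1
        rw [sum_comm]
        refine sum_congr rfl fun j _ => ?_
        rw [sum_mul]
        exact sum_congr rfl fun x _ => by rw [sum_mul]

omit [DecidableEq X] in
/-- `Q̄` is stochastic for `ψ ≥ 0` with pieces of positive mass (the tree's
`projectionChain_isRowStochastic` asks `ψ > 0`; the measure `ψ(x,i) = c_iφ_i(x)` of simulated
tempering vanishes off the supports of the `φ_i`). [cite: MadrasRandall2002, Appendix A eqs. (59),
(62)–(63)] -/
theorem projectionChain_isRowStochastic_of_nonneg {π : X → ℝ} (hπ0 : ∀ x, 0 ≤ π x)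
    {P : Matrix X X ℝ} (hP : IsRowStochastic P) {blk : X → I}
    (hM : ∀ i, 0 < blockMass π blk i) : IsRowStochastic (projectionChain π P blk) := by
  refine ⟨fun i j => ?_, fun i => ?_⟩
  · rw [projectionChain_apply]
    exact div_nonneg (blockFlow_nonneg hπ0 hP.1 blk i j) (hM i).le
  simp_rw [projectionChain_apply]
  rw [← sum_div, sum_blockFlow]
  have h : ∑ x ∈ block blk i, π x * ∑ y, P x y = blockMass π blk i := by
    unfold blockMass
    exact sum_congr rfl fun x _ => by rw [hP.2 x, mul_one]
  rw [h]
  exact div_self (hM i).ne'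

/-! ## (65)–(67): the within-piece gaps control `(g,(I−P)g)_ψ` from below by `G⋆ (g,(I−Π̂)g)_ψ` -/

/-- **Eqs. (65)–(67)**: if every restriction `P_i` satisfies the Poincaré inequality
`G⋆ Var_{ψ_i}(g) ≤ (g,(I−P_i)g)_{ψ_i}`, then `(g,(I−P)g)_ψ ≥ (g,(I−P̂)g)_ψ ≥ G⋆ Σ_i b_i Var_{ψ_i}(g)
= G⋆ (Var_ψ(g) − Var_b(Π̂g))`. [cite: MadrasRandall2002, Appendix A eqs. (65)–(67)] -/
theorem dirichletForm_ge_blocks {π : X → ℝ} (hπ0 : ∀ x, 0 ≤ π x) {P : Matrix X X ℝ}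
    (hP0 : ∀ x y, 0 ≤ P x y) {blk : X → I} (hMpos : ∀ i, 0 < blockMass π blk i) {G : ℝ}
    (hG : ∀ i g, G * lawVariance (blockLaw π blk i) g
      ≤ dirichletForm (blockLaw π blk i) (restrictionChain P blk) g) (g : X → ℝ) :
    G * (lawVariance π g - lawVariance (blockMass π blk) (blockAvg π blk g))
      ≤ dirichletForm π P g := by
  have hM : ∀ i, blockMass π blk i ≠ 0 := fun i => (hMpos i).ne'
  rw [lawVariance_decomposition hM g, add_sub_cancel_right, dirichletForm_decomposition hM P g,
    mul_sum]
  have hcross : 0 ≤ (1 / 2) * ∑ i, ∑ j ∈ univ.erase i, crossTerm π P blk g i j :=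
    mul_nonneg (by norm_num) (sum_nonneg fun i _ => sum_nonneg fun j _ =>
      crossTerm_nonneg hπ0 hP0 blk g i j)
  have hmain : ∑ i, G * (blockMass π blk i * lawVariance (blockLaw π blk i) g)
      ≤ ∑ i, blockMass π blk i * dirichletForm (blockLaw π blk i) (restrictionChain P blk) g :=
    sum_le_sum fun i _ => by
      rw [mul_left_comm]
      exact mul_le_mul_of_nonneg_left (hG i g) (hMpos i).le
  linarith

/-! ## `(f,(I−QPQ)f) = (f,(I−Q)f) + (Qf,(I−P)Qf)` -/

omit [DecidableEq X] in
/-- The first display of the proof's last paragraph (with `Q^{1/2} = Q`):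
`(f,(I−QPQ)f)_ψ = (f,(I−Q)f)_ψ + (Qf,(I−P)Qf)_ψ` for a `ψ`-reversible idempotent stochastic `Q` and a
stochastic `P` with `ψP = ψ`. [cite: MadrasRandall2002, Appendix A (proof of Theorem A.1, "Putting
the pieces together")] -/
theorem dirichletForm_QPQ_eq {π : X → ℝ} {P Q : Matrix X X ℝ} (hP : IsRowStochastic P)
    (hPst : IsStationary π P) (hQ : IsRowStochastic Q) (hQst : IsStationary π Q)
    (hQDB : DetailedBalance π Q) (hQQ : Q * Q = Q) (f : X → ℝ) :
    dirichletForm π (Q * P * Q) f = dirichletForm π Q f + dirichletForm π P (Q *ᵥ f) := by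
  have hQPQ : IsRowStochastic (Q * P * Q) := isRowStochastic_mul (isRowStochastic_mul hQ hP) hQ
  have hQPQst : IsStationary π (Q * P * Q) := isStationary_mul (isStationary_mul hQst hPst) hQst
  rw [dirichletForm_eq hQPQ hQPQst, dirichletForm_eq hQ hQst, dirichletForm_eq hP hPst]
  -- `(f, QPQf) = (Qf, PQf)` and `(Qf, Qf) = (f, QQf) = (f, Qf)`
  have h1 : piInner π f ((Q * P * Q) *ᵥ f) = piInner π (Q *ᵥ f) (P *ᵥ (Q *ᵥ f)) := by
    rw [← mulVec_mulVec, ← mulVec_mulVec, ← piInner_mulVec_comm hQDB]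
  have h2 : piInner π (Q *ᵥ f) (Q *ᵥ f) = piInner π f (Q *ᵥ f) := by
    rw [piInner_mulVec_comm hQDB, mulVec_mulVec, hQQ]
  rw [h1, h2]
  ring

/-! ## (68)–(70), replaced by Cauchy–Schwarz: `‖Π̂Qf‖² ≤ (1 − Gap(Q̄))‖f‖²` for centred `f` -/

omit [DecidableEq X] in
/-- For a `ψ`-centred `f` (`Σ ψ f = 0`), a `ψ`-reversible idempotent stochastic `Q` and a Poincaré
constant `Ḡ ≤ 1` of `Q̄` (`Ḡ Var_b(v) ≤ (v,(I−Q̄)v)_b`): with `h = Π̂(Qf)` the block averages of `Qf`,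
**`‖h‖²_b ≤ (1 − Ḡ)(f,f)_ψ`**.  Proof: `‖h‖²_b = (h̃, Qf)_ψ = (Qh̃, f)_ψ ≤ ‖Qh̃‖_ψ‖f‖_ψ` and
`‖Qh̃‖²_ψ = (h̃, Qh̃)_ψ = (h, Q̄h)_b = ‖h‖²_b − (h,(I−Q̄)h)_b ≤ (1 − Ḡ)‖h‖²_b` (`h` is `b`-centred).
This is the inequality the paper obtains from eqs. (68)–(70) (`Gap(QΠ̂Q) = Gap(Π̂QΠ̂) = Gap(Q̄)`, via
`Spec(AB)∖{0} = Spec(BA)∖{0}`). [cite: MadrasRandall2002, Appendix A eqs. (68)–(70)] -/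
theorem piInner_blockAvg_sq_le {π : X → ℝ} (hπ0 : ∀ x, 0 ≤ π x) (hπ1 : ∑ x, π x = 1)
    {Q : Matrix X X ℝ} (hQ : IsRowStochastic Q) (hQst : IsStationary π Q)
    (hQDB : DetailedBalance π Q) (hQQ : Q * Q = Q) {blk : X → I}
    (hMpos : ∀ i, 0 < blockMass π blk i)
    {Gb : ℝ} (hGb1 : Gb ≤ 1)
    (hGb : ∀ v, Gb * lawVariance (blockMass π blk) v
      ≤ dirichletForm (blockMass π blk) (projectionChain π Q blk) v)
    {f : X → ℝ} (hf : ∑ x, π x * f x = 0) :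
    piInner (blockMass π blk) (blockAvg π blk (Q *ᵥ f)) (blockAvg π blk (Q *ᵥ f))
      ≤ (1 - Gb) * piInner π f f := by
  have hM : ∀ i, blockMass π blk i ≠ 0 := fun i => (hMpos i).ne'
  have hb0 : ∀ i, 0 ≤ blockMass π blk i := fun i => (hMpos i).le
  have hb1 : ∑ i, blockMass π blk i = 1 := sum_blockMass_eq_one hπ1 blk
  set h : I → ℝ := blockAvg π blk (Q *ᵥ f) with hh
  set u : X → ℝ := blockLift blk h with hu
  -- `Qf` and hence `h` are centred
  have hQf0 : ∑ x, π x * (Q *ᵥ f) x = 0 := by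
    have := piInner_mulVec_comm hQDB (fun _ => (1 : ℝ)) f
    unfold piInner at this
    simp only [one_mul] at this
    -- `(Q1, f) = (1, Qf)` and `Q1 = 1`
    have hQ1 : Q *ᵥ (fun _ => (1 : ℝ)) = fun _ => 1 := by
      funext x
      rw [mulVec_apply_sum]
      simp only [mul_one]
      exact hQ.2 x
    rw [hQ1] at this
    simp only [one_mul] at this
    rw [← this, hf]
  have hh0 : lawMean (blockMass π blk) h = 0 := by
    rw [hh, lawMean_blockMass_blockAvg hM]
    exact hQf0
  have hVar : lawVariance (blockMass π blk) h = piInner (blockMass π blk) h h := by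
    unfold lawVariance piInner
    rw [hh0]
    exact sum_congr rfl fun i _ => by ring
  -- `‖h‖² = (ũ, Qf) = (Qũ, f)`
  have hnorm : piInner (blockMass π blk) h h = piInner π (Q *ᵥ u) f := by
    rw [piInner_mulVec_comm hQDB, hu, piInner_blockLift_left hM]
  -- `‖Qũ‖² = (ũ, Qũ) = (h, Q̄h) ≤ (1 − Ḡ)‖h‖²`
  have hQu : piInner π (Q *ᵥ u) (Q *ᵥ u) ≤ (1 - Gb) * piInner (blockMass π blk) h h := by
    rw [piInner_mulVec_comm hQDB, mulVec_mulVec, hQQ, hu, piInner_blockLift_mulVec_blockLift hM]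
    have hQb : IsRowStochastic (projectionChain π Q blk) :=
      projectionChain_isRowStochastic_of_nonneg hπ0 hQ hMpos
    have hQbst : IsStationary (blockMass π blk) (projectionChain π Q blk) :=
      projectionChain_isStationary hQst hM
    have hE := dirichletForm_eq hQb hQbst h
    have hG := hGb h
    rw [hVar] at hG
    linarith
  -- Cauchy–Schwarz `(Qũ, f)² ≤ ‖Qũ‖²‖f‖²`
  have hCS : piInner π (Q *ᵥ u) f ^ 2 ≤ piInner π (Q *ᵥ u) (Q *ᵥ u) * piInner π f f := by
    have hcs := sum_mul_sq_le_sq_mul_sq univ (fun z => Real.sqrt (π z) * (Q *ᵥ u) z)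
      (fun z => Real.sqrt (π z) * f z)
    have e : ∀ a c : X → ℝ, ∑ z, Real.sqrt (π z) * a z * (Real.sqrt (π z) * c z) = piInner π a c := by
      intro a c
      unfold piInner
      refine sum_congr rfl fun z _ => ?_
      have := Real.mul_self_sqrt (hπ0 z)
      calc Real.sqrt (π z) * a z * (Real.sqrt (π z) * c z)
          = Real.sqrt (π z) * Real.sqrt (π z) * (a z * c z) := by ring
        _ = π z * (a z * c z) := by rw [this]
    have e2 : ∀ a : X → ℝ, ∑ z, (Real.sqrt (π z) * a z) ^ 2 = piInner π a a := by
      intro a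
      rw [← e a a]
      exact sum_congr rfl fun z _ => by ring
    rw [e, e2, e2] at hcs
    exact hcs
  -- conclude: `N² ≤ (1−Ḡ) N ‖f‖²` with `N = ‖h‖² ≥ 0`
  set N := piInner (blockMass π blk) h h with hN
  have hN0 : 0 ≤ N := by
    rw [hN]
    unfold piInner
    exact sum_nonneg fun i _ => mul_nonneg (hb0 i) (mul_self_nonneg _)
  have hff0 : 0 ≤ piInner π f f := by
    unfold piInner
    exact sum_nonneg fun x _ => mul_nonneg (hπ0 x) (mul_self_nonneg _)
  have hkey : N ^ 2 ≤ (1 - Gb) * N * piInner π f f := by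
    calc N ^ 2 = piInner π (Q *ᵥ u) f ^ 2 := by rw [hnorm]
      _ ≤ piInner π (Q *ᵥ u) (Q *ᵥ u) * piInner π f f := hCS
      _ ≤ (1 - Gb) * N * piInner π f f := mul_le_mul_of_nonneg_right hQu hff0
  rcases hN0.eq_or_lt with hz | hpos
  · rw [← hz]
    exact mul_nonneg (by linarith) hff0
  · nlinarith

/-! ## Theorem A.1 (projection case) / Theorem 2.1 -/

/-- **THEOREM A.1 (Caracciolo–Pelissetto–Sokal), case `Q² = Q`, Poincaré form.**  `ψ ≥ 0` a
probability vector on a finite `𝒮` partitioned into pieces `𝒮_i` of positive `ψ`-mass; `P` stochastic and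
`ψ`-reversible; `Q` stochastic, `ψ`-reversible and idempotent (`Q² = Q`).  If the restrictions satisfy
`G⋆ Var_{ψ_i}(g) ≤ (g,(I−P_i)g)_{ψ_i}` for all `i, g` with `0 ≤ G⋆ ≤ 1`, and the aggregated chain
satisfies `Ḡ Var_b(v) ≤ (v,(I−Q̄)v)_b` for all `v` with `Ḡ ≤ 1`, then for every `f`,
**`G⋆ Ḡ · Var_ψ(f) ≤ (f,(I − QPQ)f)_ψ`**. [cite: MadrasRandall2002, Appendix A Theorem A.1 (proof,
eqs. (65)–(70) and the final display); §2 Theorem 2.1] -/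
theorem CaraccioloPelissettoSokal_poincare {π : X → ℝ} (hπ0 : ∀ x, 0 ≤ π x) (hπ1 : ∑ x, π x = 1)
    {P Q : Matrix X X ℝ} (hP : IsRowStochastic P) (hPDB : DetailedBalance π P)
    (hQ : IsRowStochastic Q) (hQDB : DetailedBalance π Q) (hQQ : Q * Q = Q) {blk : X → I}
    (hMpos : ∀ i, 0 < blockMass π blk i) {G Gb : ℝ} (hG0 : 0 ≤ G) (hG1 : G ≤ 1) (hGb1 : Gb ≤ 1)
    (hG : ∀ i g, G * lawVariance (blockLaw π blk i) g
      ≤ dirichletForm (blockLaw π blk i) (restrictionChain P blk) g)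
    (hGb : ∀ v, Gb * lawVariance (blockMass π blk) v
      ≤ dirichletForm (blockMass π blk) (projectionChain π Q blk) v) (f : X → ℝ) :
    G * Gb * lawVariance π f ≤ dirichletForm π (Q * P * Q) f := by
  have hPst : IsStationary π P := hPDB.isStationary hP.2
  have hQst : IsStationary π Q := hQDB.isStationary hQ.2
  -- reduce to a centred `f`
  set m := lawMean π f with hm
  set f₀ : X → ℝ := fun x => f x - m with hf₀
  have hf₀0 : ∑ x, π x * f₀ x = 0 := sum_mul_sub_lawMean hπ1 f
  have hVf : lawVariance π f = piInner π f₀ f₀ := by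
    unfold lawVariance piInner
    exact sum_congr rfl fun x _ => by rw [hf₀]; ring
  have hEf : dirichletForm π (Q * P * Q) f = dirichletForm π (Q * P * Q) f₀ :=
    (dirichletForm_sub_const π (Q * P * Q) f m).symm
  rw [hVf, hEf, dirichletForm_QPQ_eq hP hPst hQ hQst hQDB hQQ f₀]
  -- (65)–(67) for `g = Qf₀`, and `Var_ψ(Qf₀) = (Qf₀,Qf₀) = (f₀, Qf₀)`, `Var_b(Π̂Qf₀) = ‖Π̂Qf₀‖²`
  have hblocks := dirichletForm_ge_blocks hπ0 hP.1 hMpos hG (Q *ᵥ f₀)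
  have hM : ∀ i, blockMass π blk i ≠ 0 := fun i => (hMpos i).ne'
  have hQf0 : ∑ x, π x * (Q *ᵥ f₀) x = 0 := by
    have h1 := piInner_mulVec_comm hQDB (fun _ => (1 : ℝ)) f₀
    have hQ1 : Q *ᵥ (fun _ => (1 : ℝ)) = fun _ => 1 := by
      funext x
      rw [mulVec_apply_sum]
      simp only [mul_one]
      exact hQ.2 x
    rw [hQ1] at h1
    unfold piInner at h1
    simp only [one_mul] at h1
    rw [← h1, hf₀0]
  have hVQ : lawVariance π (Q *ᵥ f₀) = piInner π f₀ (Q *ᵥ f₀) := by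
    have hmean : lawMean π (Q *ᵥ f₀) = 0 := hQf0
    have h1 : lawVariance π (Q *ᵥ f₀) = piInner π (Q *ᵥ f₀) (Q *ᵥ f₀) := by
      unfold lawVariance piInner
      rw [hmean]
      exact sum_congr rfl fun x _ => by ring
    rw [h1, piInner_mulVec_comm hQDB, mulVec_mulVec, hQQ]
  have hVb : lawVariance (blockMass π blk) (blockAvg π blk (Q *ᵥ f₀))
      = piInner (blockMass π blk) (blockAvg π blk (Q *ᵥ f₀)) (blockAvg π blk (Q *ᵥ f₀)) := by
    have hmean : lawMean (blockMass π blk) (blockAvg π blk (Q *ᵥ f₀)) = 0 := by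
      rw [lawMean_blockMass_blockAvg hM]
      exact hQf0
    unfold lawVariance piInner
    rw [hmean]
    exact sum_congr rfl fun i _ => by ring
  -- (68)–(70)′
  have h70 := piInner_blockAvg_sq_le hπ0 hπ1 hQ hQst hQDB hQQ hMpos hGb1 hGb hf₀0
  -- `(f₀,(I−Q)f₀) ≥ 0`
  have hEQ0 : 0 ≤ dirichletForm π Q f₀ := dirichletForm_nonneg hπ0 hQ.1 f₀
  have hEQ : dirichletForm π Q f₀ = piInner π f₀ f₀ - piInner π f₀ (Q *ᵥ f₀) :=
    dirichletForm_eq hQ hQst f₀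
  rw [hVQ, hVb] at hblocks
  -- assemble: 𝓔_Q + 𝓔_P(Qf₀) ≥ 𝓔_Q + G((f₀,Qf₀) − ‖h‖²) ≥ G(𝓔_Q + (f₀,Qf₀) − ‖h‖²)
  --   = G((f₀,f₀) − ‖h‖²) ≥ G((f₀,f₀) − (1−Ḡ)(f₀,f₀)) = GḠ(f₀,f₀)
  have hff0 : 0 ≤ piInner π f₀ f₀ := by
    unfold piInner
    exact sum_nonneg fun x _ => mul_nonneg (hπ0 x) (mul_self_nonneg _)
  nlinarith [mul_nonneg hG0 (sub_nonneg.mpr h70), mul_nonneg (sub_nonneg.mpr hG1) hEQ0]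

/-- **THEOREM A.1 (projection case) / THEOREM 2.1 as a gap bound**: with `Gap` the variational gap
`spectralGapR`, `Q̄ = projectionChain ψ Q`, `P_i = restrictionChain P` on the piece `𝒮_i` with law
`ψ_i`: **`Gap(QPQ) ≥ Gap(Q̄) · min{1, min_i Gap(P_i)}`** (the printed (64)/(20): `Gap(Q̄) min_i
Gap(P_i)`, whose proof uses `min_i Gap(P_i) ≤ 1`).  For `ψ ≥ 0` with at least two pieces of positive
mass and `ψ` not a point mass (`ψ`-mass of some set in `(0, ½]`, as in the tree's Theorem 13.10).
[cite: MadrasRandall2002, Appendix A Theorem A.1 eq. (64); §2 Theorem 2.1 eq. (20)] -/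
theorem MadrasRandall2002_thm_A_1_projection [Nontrivial I] {π : X → ℝ} (hπ0 : ∀ x, 0 ≤ π x)
    (hπ1 : ∑ x, π x = 1) {P Q : Matrix X X ℝ} (hP : IsRowStochastic P) (hPDB : DetailedBalance π P)
    (hQ : IsRowStochastic Q) (hQDB : DetailedBalance π Q) (hQQ : Q * Q = Q) {blk : X → I}
    (hMpos : ∀ i, 0 < blockMass π blk i)
    (hX : ∃ S : Finset X, 0 < ∑ x ∈ S, π x ∧ ∑ x ∈ S, π x ≤ 1 / 2) :
    spectralGapR (blockMass π blk) (projectionChain π Q blk)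
        * min 1 (⨅ i, spectralGapR (blockLaw π blk i) (restrictionChain P blk))
      ≤ spectralGapR π (Q * P * Q) := by
  have hM : ∀ i, blockMass π blk i ≠ 0 := fun i => (hMpos i).ne'
  have hb0 : ∀ i, 0 ≤ blockMass π blk i := fun i => (hMpos i).le
  have hb1 : ∑ i, blockMass π blk i = 1 := sum_blockMass_eq_one hπ1 blk
  have hQb : IsRowStochastic (projectionChain π Q blk) :=
    projectionChain_isRowStochastic_of_nonneg hπ0 hQ hMpos
  have hQbst : IsStationary (blockMass π blk) (projectionChain π Q blk) :=
    projectionChain_isStationary (hQDB.isStationary hQ.2) hM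
  -- the Poincaré constants: `Ḡ = Gap_R(b, Q̄)` and `G⋆ = min{1, ⨅_i Gap_R(ψ_i, P_i)}`
  set Gb := spectralGapR (blockMass π blk) (projectionChain π Q blk) with hGbeq
  set Gm := ⨅ i, spectralGapR (blockLaw π blk i) (restrictionChain P blk) with hGm
  have hGb : ∀ v, Gb * lawVariance (blockMass π blk) v
      ≤ dirichletForm (blockMass π blk) (projectionChain π Q blk) v := fun v =>
    spectralGapR_mul_lawVariance_le hb0 hb1 hQb.1 v
  -- `Ḡ ≤ 1`: with two pieces there is an admissible `v`, and `(v, Q̄v)_b = ‖Qṽ‖² ≥ 0`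
  have hGb1 : Gb ≤ 1 := by
    obtain ⟨i₀, i₁, hne⟩ := exists_pair_ne I
    -- a set of `b`-mass in `(0, ½]`: one of the singletons `{i₀}`, `{i₁}`ᶜ-style choice
    have hXb : ∃ T : Finset I, 0 < ∑ i ∈ T, blockMass π blk i ∧ ∑ i ∈ T, blockMass π blk i ≤ 1 / 2 := by
      by_cases h : blockMass π blk i₀ ≤ 1 / 2
      · exact ⟨{i₀}, by rw [sum_singleton]; exact ⟨hMpos i₀, h⟩⟩
      · refine ⟨{i₁}, ?_⟩
        rw [sum_singleton]
        refine ⟨hMpos i₁, ?_⟩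
        have hle : blockMass π blk i₀ + blockMass π blk i₁ ≤ ∑ i, blockMass π blk i := by
          rw [← sum_pair hne]
          exact sum_le_sum_of_subset_of_nonneg (subset_univ _) fun i _ _ => hb0 i
        linarith
    obtain ⟨v, hv0, hv1⟩ := exists_mean_zero_piInner_one hb1 hXb
    have hle := spectralGapR_le_dirichletForm hb0 hQb.1 hv0 hv1
    rw [dirichletForm_eq hQb hQbst, hv1] at hle
    -- `(v, Q̄v)_b = (ṽ, Qṽ)_ψ = ‖Qṽ‖²_ψ ≥ 0`
    have hpos : 0 ≤ piInner (blockMass π blk) v (projectionChain π Q blk *ᵥ v) := by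
      rw [← piInner_blockLift_mulVec_blockLift hM, ← hQQ, ← mulVec_mulVec,
        ← piInner_mulVec_comm hQDB]
      unfold piInner
      exact sum_nonneg fun x _ => mul_nonneg (hπ0 x) (mul_self_nonneg _)
    linarith
  have hGm0 : 0 ≤ Gm :=
    le_ciInf fun i => spectralGapR_nonneg (blockLaw_nonneg hπ0 blk i)
      (restrictionChain_isRowStochastic hP blk).1
  have hG : ∀ i g, min 1 Gm * lawVariance (blockLaw π blk i) g
      ≤ dirichletForm (blockLaw π blk i) (restrictionChain P blk) g := by
    intro i g
    have h1 : min 1 Gm ≤ spectralGapR (blockLaw π blk i) (restrictionChain P blk) :=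
      (min_le_right _ _).trans (ciInf_le (Set.finite_range _).bddBelow i)
    exact (mul_le_mul_of_nonneg_right h1 (lawVariance_nonneg (blockLaw_nonneg hπ0 blk i) g)).trans
      (spectralGapR_mul_lawVariance_le (blockLaw_nonneg hπ0 blk i) (sum_blockLaw (hM i))
        (restrictionChain_isRowStochastic hP blk).1 g)
  have hP' := CaraccioloPelissettoSokal_poincare hπ0 hπ1 hP hPDB hQ hQDB hQQ hMpos
    (le_min zero_le_one hGm0) (min_le_left _ _) hGb1 hG hGb
  -- Poincaré ⇒ gap
  obtain ⟨g₀, hg₀0, hg₀1⟩ := exists_mean_zero_piInner_one hπ1 hX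
  refine le_csInf ⟨_, ⟨g₀, ⟨hg₀0, hg₀1⟩, rfl⟩⟩ ?_
  rintro _ ⟨f, ⟨hf0, hf1⟩, rfl⟩
  have hvar : lawVariance π f = 1 := by
    have hmean : lawMean π f = 0 := hf0
    unfold lawVariance
    rw [hmean]
    unfold piInner at hf1
    rw [← hf1]
    exact sum_congr rfl fun x _ => by ring
  have h := hP' f
  rw [hvar, mul_one, mul_comm] at h
  exact h

/-- **Theorem 2.1 with the spectral readings of (55)**: `Gap(QPQ) = 1 − λ₂(QPQ)` and
`Gap(Q̄) = 1 − λ₂(Q̄)` ("In the case that `𝒮` is finite, this simply says that `Gap(R)` is one minus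
the second-largest eigenvalue of `R`" — the tree's Lemma 13.7 for the `ψ`-reversible `QPQ` and the
`b`-reversible `Q̄`): **`1 − λ₂(QPQ) ≥ (1 − λ₂(Q̄)) · min{1, min_i Gap_R(ψ_i, P_i)}`** (`|𝒮| ≥ 2`, at
least two pieces). [cite: MadrasRandall2002, Appendix A eq. (55) and Theorem A.1 eq. (64); §2
Theorem 2.1 eq. (20)] -/
theorem MadrasRandall2002_thm_A_1_projection_spectralGap [Nontrivial X] [Nontrivial I] {π : X → ℝ}
    (hπ : ∀ x, 0 < π x) (hπ1 : ∑ x, π x = 1) {P Q : Matrix X X ℝ} (hP : IsRowStochastic P)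
    (hPDB : DetailedBalance π P) (hQ : IsRowStochastic Q) (hQDB : DetailedBalance π Q)
    (hQQ : Q * Q = Q) {blk : X → I} (hblk : Function.Surjective blk) :
    spectralGap (blockMass π blk) (projectionChain π Q blk)
        * min 1 (⨅ i, spectralGapR (blockLaw π blk i) (restrictionChain P blk))
      ≤ spectralGap π (Q * P * Q) := by
  have hQPQ : IsRowStochastic (Q * P * Q) := isRowStochastic_mul (isRowStochastic_mul hQ hP) hQ
  -- `QPQ` is `ψ`-reversible: `ψ(x)(QPQ)(x,y) = Σ_{z,w} ψ(x)Q(x,z)P(z,w)Q(w,y)` is symmetric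
  have hQPQDB : DetailedBalance π (Q * P * Q) := by
    intro x y
    rw [mul_apply_sum, mul_apply_sum, mul_sum, mul_sum]
    simp_rw [mul_apply_sum, sum_mul, mul_sum]
    rw [sum_comm]
    refine sum_congr rfl fun z _ => sum_congr rfl fun w _ => ?_
    -- `ψ(x)Q(x,z)P(z,w)Q(w,y) = ψ(y)Q(y,w)P(w,z)Q(z,x)`: multiply the three balance relations
    have key : π z * π w * (π x * (Q x z * P z w * Q w y))
        = π z * π w * (π y * (Q y w * P w z * Q z x)) := by
      calc π z * π w * (π x * (Q x z * P z w * Q w y))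
          = (π x * Q x z) * (π z * P z w) * (π w * Q w y) := by ring
        _ = (π z * Q z x) * (π w * P w z) * (π y * Q y w) := by rw [hQDB x z, hPDB z w, hQDB w y]
        _ = π z * π w * (π y * (Q y w * P w z * Q z x)) := by ring
    exact mul_left_cancel₀ (mul_ne_zero (hπ z).ne' (hπ w).ne') key
  -- a set of `ψ`-mass in `(0, ½]` exists since `|𝒮| ≥ 2` and `ψ > 0`
  have hX : ∃ S : Finset X, 0 < ∑ x ∈ S, π x ∧ ∑ x ∈ S, π x ≤ 1 / 2 := by
    obtain ⟨x₀, x₁, hne⟩ := exists_pair_ne X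
    by_cases h : π x₀ ≤ 1 / 2
    · exact ⟨{x₀}, by rw [sum_singleton]; exact ⟨hπ x₀, h⟩⟩
    · refine ⟨{x₁}, ?_⟩
      rw [sum_singleton]
      refine ⟨hπ x₁, ?_⟩
      have hle : π x₀ + π x₁ ≤ ∑ x, π x := by
        rw [← sum_pair hne]
        exact sum_le_sum_of_subset_of_nonneg (subset_univ _) fun x _ _ => (hπ x).le
      linarith
  rw [spectralGap_projectionChain hπ hπ1 hQ hQDB hblk, LevinPeres2017_lemma_13_7 hπ hπ1 hQPQ hQPQDB]
  exact MadrasRandall2002_thm_A_1_projection (fun x => (hπ x).le) hπ1 hP hPDB hQ hQDB hQQ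
    (blockMass_pos hπ hblk) hX

end Literature.Probability.MarkovChains.Decomposition

/-! # PART B — §4, eqs. (32)–(38): the pieces `T_i = P[κ][φ_i]` versus `P[A_i]`, and the crude chain
# `P_H` versus the aggregated matrix `Q̄` (vocabulary of `DensityDecomposition.lean`)

[cite: MadrasRandall2002, §1 eqs. (1)–(5) and §4 eqs. (32)–(38)].  With the cover `A_0, …, A_D`,
`φ_i = π1_{A_i}/π[A_i]`, `Z`, `N(x) = #{i : x ∈ A_i} ≤ Θ`, `c_i = π[A_i]/Z` and the umbrella density
`κ = Σ c_iφ_i = πN/Z` of the fourth block: `R = P[κ]`, `T_i = R[φ_i]` (32); PROVED: (33)–(34)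
`Θ⁻¹ P[φ_i](x,y) ≤ T_i(x,y) ≤ P[φ_i](x,y)` off the diagonal (`coverPiece_ge`, `coverPiece_le`), (35)
`Θ⁻¹ Gap(P[φ_i]) ≤ Gap(T_i)` (`MadrasRandall2002_eq_35`; with `P[φ_i] = P[A_i]`, the restriction (1),
`mhKernel_pieceLaw_of_mem`), the crude chain `P_H` of eq. (5) (`coverChain`), the aggregated matrix
`Q̄(i,j) = c_j Σ_x φ_i(x)φ_j(x)/κ(x)` of eqs. (19)/(36) (`labelChain`), (37) `P_H(i,j) ≤ Q̄(i,j) ≤ Θ P_H(i,j)`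
for `i ≠ j` (`coverChain_le_labelChain`, `labelChain_le_coverChain`) and the lower half of (38),
`Gap(P_H) ≤ Gap(Q̄)` (`MadrasRandall2002_eq_38`), and `MadrasRandall2002_prop_3_2'` (Proposition 3.2 asking
`Σφ_j = 1` only for `j ≤ D`).  What then remains of Theorem 1.1's proof (39) is
Theorem 2.1 (PART A) on `Ω × {0,…,D}` — PART C. -/

namespace Literature.Probability.MarkovChains.DensityDecomposition

open Finset Matrix

variable {X : Type*} [Fintype X] [DecidableEq X]

/-- `Z = Σ_i π[A_i]`. [cite: MadrasRandall2002, §1 eq. (2)] -/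
def coverZ (π : X → ℝ) (A : ℕ → Finset X) (D : ℕ) : ℝ := ∑ j ∈ range (D + 1), pieceMass π (A j)

/-- The umbrella density `κ = Σ_i (π[A_i]/Z) φ_i` of the cover. [cite: MadrasRandall2002, §4 eqs.
(27)–(28)] -/
noncomputable def coverMixture (π : X → ℝ) (A : ℕ → Finset X) (D : ℕ) : X → ℝ :=
  mixture (fun i => pieceMass π (A i) / coverZ π A D) (fun i => pieceLaw π (A i)) D

omit [Fintype X] in
/-- `κ(x) = π(x)N(x)/Z`. [cite: MadrasRandall2002, §4 eqs. (27)–(29)] -/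
theorem coverMixture_apply {π : X → ℝ} {A : ℕ → Finset X} {D : ℕ}
    (hA : ∀ i ≤ D, pieceMass π (A i) ≠ 0) (x : X) :
    coverMixture π A D x = π x * coverCount A D x / coverZ π A D :=
  coverMixture_eq hA _ x

omit [Fintype X] in
/-- `1 ≤ N(x)` for a cover. [cite: MadrasRandall2002, §1 eq. (4) (`1 ≤ Z ≤ Θ`)] -/
theorem one_le_coverCount {A : ℕ → Finset X} {D : ℕ} (hcover : ∀ x, ∃ i ≤ D, x ∈ A i) (x : X) :
    1 ≤ coverCount A D x := by
  obtain ⟨i, hi, hx⟩ := hcover x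
  exact card_pos.mpr ⟨i, mem_filter.mpr ⟨mem_range.mpr (Nat.lt_succ_of_le hi), hx⟩⟩

omit [Fintype X] [DecidableEq X] in
/-- `Z > 0` when the pieces have positive mass. [cite: MadrasRandall2002, §1 eq. (4)] -/
theorem coverZ_pos {π : X → ℝ} {A : ℕ → Finset X} {D : ℕ} (hA : ∀ i ≤ D, 0 < pieceMass π (A i)) :
    0 < coverZ π A D := by
  have h0 : pieceMass π (A 0) ≤ coverZ π A D :=
    single_le_sum (f := fun j => pieceMass π (A j)) (fun j hj => (hA j
      (Nat.lt_succ_iff.mp (mem_range.mp hj))).le) (mem_range.mpr (Nat.succ_pos D))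
  linarith [hA 0 (Nat.zero_le D)]

/-! ## (32)–(34): the pieces `T_i = P[κ][φ_i]` -/

/-- Off the diagonal and inside `A_i`, `P[φ_i](x,y) = P(x,y)` for a `π`-reversible `P` ("the restriction
`P[A_i]` of `P` to `A_i` is the same as the Metropolis–Hastings chain `P[φ_i]`").
[cite: MadrasRandall2002, §4 (the sentence before eq. (32)); §1 eq. (1)] -/
theorem mhKernel_pieceLaw_of_mem {π : X → ℝ} (hπ : ∀ x, 0 < π x) {P : X → X → ℝ}
    (hDB : DetailedBalance π P) {A : Finset X} {x y : X} (hx : x ∈ A) (hy : y ∈ A) (hxy : y ≠ x) :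
    mhKernel P (pieceLaw π A) x y = P x y := by
  rw [mhKernel_of_ne hxy]
  unfold mhRate pieceLaw
  rw [if_pos hx, if_pos hy]
  have hM : pieceMass π A ≠ 0 := (sum_pos (fun z _ => hπ z) ⟨x, hx⟩).ne'
  have : π y / pieceMass π A * P y x / (π x / pieceMass π A) = P x y := by
    rw [div_eq_iff (div_ne_zero (hπ x).ne' hM), div_mul_eq_mul_div, ← hDB x y]
    ring
  rw [this, min_self]

/-- Off the diagonal, `P[φ_i](x,y) = 0` unless both `x, y ∈ A_i` (`P ≥ 0`).
[cite: MadrasRandall2002, §1 eq. (1), eq. (9) (zero-denominator convention)] -/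
theorem mhKernel_pieceLaw_of_not_mem {π : X → ℝ} {P : X → X → ℝ} (hP : ∀ x y, 0 ≤ P x y)
    {A : Finset X} {x y : X} (h : x ∉ A ∨ y ∉ A) (hxy : y ≠ x) :
    mhKernel P (pieceLaw π A) x y = 0 := by
  rw [mhKernel_of_ne hxy]
  unfold mhRate pieceLaw
  rcases h with hx | hy
  · rw [if_neg hx, div_zero]
    exact min_eq_right (hP x y)
  · rw [if_neg hy, zero_mul, zero_div]
    exact min_eq_right (hP x y)

/-- **Eqs. (33)–(34)**: with `R = P[κ]` and `T_i = R[φ_i]`, for `x ≠ y`: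
**`Θ⁻¹ P[φ_i](x,y) ≤ T_i(x,y) ≤ P[φ_i](x,y)`** (`P` `π`-reversible with `π > 0`, `P ≥ 0`; cover of
multiplicity `≤ Θ`).  Inside `A_i`: `T_i(x,y) = P(x,y) min{N(y)/N(x), N(x)/N(y)} ∈ [P(x,y)/Θ, P(x,y)]`;
otherwise both sides vanish. [cite: MadrasRandall2002, §4 eqs. (33)–(34)] -/
theorem coverPiece_bounds {π : X → ℝ} (hπ : ∀ x, 0 < π x) {P : X → X → ℝ} (hP : ∀ x y, 0 ≤ P x y)
    (hProw : ∀ x, ∑ y, P x y ≤ 1) (hDB : DetailedBalance π P) {A : ℕ → Finset X} {D : ℕ}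
    (hA : ∀ i ≤ D, 0 < pieceMass π (A i)) (hcover : ∀ x, ∃ i ≤ D, x ∈ A i) {Θ : ℕ}
    (hΘ : ∀ x, coverCount A D x ≤ Θ) {i : ℕ} (hi : i ≤ D) {x y : X} (hxy : y ≠ x) :
    1 / Θ * mhKernel P (pieceLaw π (A i)) x y
        ≤ mhKernel (mhKernel P (coverMixture π A D)) (pieceLaw π (A i)) x y ∧
      mhKernel (mhKernel P (coverMixture π A D)) (pieceLaw π (A i)) x y
        ≤ mhKernel P (pieceLaw π (A i)) x y := by
  set κ := coverMixture π A D with hκ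
  set N : X → ℝ := fun z => (coverCount A D z : ℝ) with hN
  have hA' : ∀ j ≤ D, pieceMass π (A j) ≠ 0 := fun j hj => (hA j hj).ne'
  have hZ : 0 < coverZ π A D := coverZ_pos hA
  have hN1 : ∀ z, 1 ≤ N z := fun z => by
    simp only [hN]; exact_mod_cast one_le_coverCount hcover z
  have hNΘ : ∀ z, N z ≤ Θ := fun z => by simp only [hN]; exact_mod_cast hΘ z
  have hNpos : ∀ z, 0 < N z := fun z => lt_of_lt_of_le one_pos (hN1 z)
  have hΘ1 : (1 : ℝ) ≤ Θ := (hN1 x).trans (hNΘ x)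
  have hΘpos : (0 : ℝ) < Θ := lt_of_lt_of_le one_pos hΘ1
  have hκx : ∀ z, κ z = π z * N z / coverZ π A D := fun z => coverMixture_apply hA' z
  have hκpos : ∀ z, 0 < κ z := fun z => by
    rw [hκx z]; exact div_pos (mul_pos (hπ z) (hNpos z)) hZ
  have hκ0 : ∀ z, 0 ≤ κ z := fun z => (hκpos z).le
  -- the proposal `R = P[κ]`: `R(x,y) = min{P(x,y), P(x,y)N(y)/N(x)}` off the diagonal
  have hR : ∀ u v, v ≠ u → mhKernel P κ u v = min (P u v) (P u v * (N v / N u)) := by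
    intro u v huv
    rw [mhKernel_of_ne huv]
    unfold mhRate
    congr 1
    rw [hκx u, hκx v]
    have hden : π u * N u / coverZ π A D ≠ 0 :=
      div_ne_zero (mul_ne_zero (hπ u).ne' (hNpos u).ne') hZ.ne'
    rw [div_eq_iff hden]
    have e1 : π v * N v / coverZ π A D * P v u = (π v * P v u) * (N v / coverZ π A D) := by ring
    have e2 : P u v * (N v / N u) * (π u * N u / coverZ π A D)
        = (π u * P u v) * (N v / coverZ π A D) * (N u / N u) := by ring
    rw [e2, div_self (hNpos u).ne', mul_one, e1, ← hDB u v]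
  have hR0 : ∀ u v, 0 ≤ mhKernel P κ u v := fun u v => mhKernel_nonneg_of_nonneg hκ0 hP hProw u v
  have hT0 : 0 ≤ mhKernel (mhKernel P κ) (pieceLaw π (A i)) x y :=
    mhKernel_nonneg_of_nonneg (pieceLaw_nonneg (fun z => (hπ z).le) (A i)) hR0
      (fun u => (mhKernel_sum_eq_one P κ u).le) x y
  have hΘinv1 : 1 / (Θ : ℝ) ≤ 1 := by rw [div_le_one hΘpos]; exact hΘ1
  have hΘinv0 : 0 ≤ 1 / (Θ : ℝ) := by positivity
  have hratio : ∀ u v, 1 / (Θ : ℝ) ≤ N u / N v := fun u v => by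
    rw [div_le_div_iff₀ hΘpos (hNpos v)]
    nlinarith [hN1 u, hNΘ v]
  by_cases hmem : x ∈ A i ∧ y ∈ A i
  · obtain ⟨hx, hy⟩ := hmem
    have hM : pieceMass π (A i) ≠ 0 := hA' i hi
    rw [mhKernel_pieceLaw_of_mem hπ hDB hx hy hxy, mhKernel_of_ne hxy]
    unfold mhRate
    have hφ : pieceLaw π (A i) y * mhKernel P κ y x / pieceLaw π (A i) x
        = π y * mhKernel P κ y x / π x := by
      unfold pieceLaw
      rw [if_pos hx, if_pos hy]
      field_simp
    rw [hφ, hR x y hxy, hR y x (Ne.symm hxy)]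
    constructor
    · refine le_min (le_min (mul_le_of_le_one_left (hP x y) hΘinv1) ?_) ?_
      · rw [mul_comm]
        exact mul_le_mul_of_nonneg_left (hratio y x) (hP x y)
      · rw [le_div_iff₀ (hπ x), mul_min_of_nonneg _ _ (hπ y).le, ← mul_assoc, ← hDB x y]
        refine le_min ?_ ?_
        · calc 1 / (Θ : ℝ) * P x y * π x = 1 / Θ * (π x * P x y) := by ring
            _ ≤ π x * P x y := mul_le_of_le_one_left (mul_nonneg (hπ x).le (hP x y)) hΘinv1
        · calc 1 / (Θ : ℝ) * P x y * π x = π x * P x y * (1 / Θ) := by ring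
            _ ≤ π x * P x y * (N x / N y) :=
                mul_le_mul_of_nonneg_left (hratio x y) (mul_nonneg (hπ x).le (hP x y))
    · exact (min_le_left _ _).trans (min_le_left _ _)
  · -- outside `A_i × A_i` both kernels vanish off the diagonal
    have h0 : mhKernel P (pieceLaw π (A i)) x y = 0 :=
      mhKernel_pieceLaw_of_not_mem hP (by tauto) hxy
    have hT : mhKernel (mhKernel P κ) (pieceLaw π (A i)) x y = 0 :=
      mhKernel_pieceLaw_of_not_mem hR0 (by tauto) hxy
    rw [h0, hT, mul_zero]
    exact ⟨le_rfl, le_rfl⟩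

/-- **Eq. (35), lower half**: `Θ⁻¹ Gap(P[φ_i]) ≤ Gap(T_i)` — both chains are `φ_i`-reversible and
`T_i ≥ Θ⁻¹P[φ_i]` off the diagonal, so `𝓔_{T_i} ≥ Θ⁻¹𝓔_{P[φ_i]}` and the variational gap (7) follows
(for a one-point piece both sides are the empty infimum `0`). [cite: MadrasRandall2002, §4 eq. (35)] -/
theorem MadrasRandall2002_eq_35 {π : X → ℝ} (hπ : ∀ x, 0 < π x) {P : X → X → ℝ}
    (hP : ∀ x y, 0 ≤ P x y) (hProw : ∀ x, ∑ y, P x y ≤ 1) (hDB : DetailedBalance π P)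
    {A : ℕ → Finset X} {D : ℕ} (hA : ∀ i ≤ D, 0 < pieceMass π (A i))
    (hcover : ∀ x, ∃ i ≤ D, x ∈ A i) {Θ : ℕ} (hΘ : ∀ x, coverCount A D x ≤ Θ) {i : ℕ} (hi : i ≤ D) :
    1 / Θ * spectralGapR (pieceLaw π (A i)) (mhKernel P (pieceLaw π (A i)) : Matrix X X ℝ)
      ≤ spectralGapR (pieceLaw π (A i))
        (mhKernel (mhKernel P (coverMixture π A D)) (pieceLaw π (A i)) : Matrix X X ℝ) := by
  set φ := pieceLaw π (A i) with hφ
  set κ := coverMixture π A D with hκ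
  have hπ0 : ∀ x, 0 ≤ π x := fun x => (hπ x).le
  have hφ0 : ∀ x, 0 ≤ φ x := pieceLaw_nonneg hπ0 (A i)
  have hφ1 : ∑ x, φ x = 1 := sum_pieceLaw (hA i hi).ne'
  have hA' : ∀ j ≤ D, pieceMass π (A j) ≠ 0 := fun j hj => (hA j hj).ne'
  have hκ0 : ∀ x, 0 ≤ κ x := fun x => by
    rw [hκ, coverMixture_apply hA' x]
    exact div_nonneg (mul_nonneg (hπ0 x) (Nat.cast_nonneg _)) (coverZ_pos hA).le
  have hR0 : ∀ u v, 0 ≤ mhKernel P κ u v := fun u v => mhKernel_nonneg_of_nonneg hκ0 hP hProw u v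
  have hPφ0 : ∀ x y, 0 ≤ (mhKernel P φ : Matrix X X ℝ) x y := fun x y =>
    mhKernel_nonneg_of_nonneg hφ0 hP hProw x y
  have hT0 : ∀ x y, 0 ≤ (mhKernel (mhKernel P κ) φ : Matrix X X ℝ) x y := fun x y =>
    mhKernel_nonneg_of_nonneg hφ0 hR0 (fun u => (mhKernel_sum_eq_one P κ u).le) x y
  -- Dirichlet forms: `Θ⁻¹ 𝓔_{P[φ]} ≤ 𝓔_{T}` (off-diagonal comparison (34))
  have hE : ∀ f : X → ℝ, 1 / Θ * dirichletForm φ (mhKernel P φ : Matrix X X ℝ) f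
      ≤ dirichletForm φ (mhKernel (mhKernel P κ) φ : Matrix X X ℝ) f := by
    intro f
    unfold dirichletForm
    rw [mul_left_comm, mul_sum]
    refine mul_le_mul_of_nonneg_left (sum_le_sum fun x _ => ?_) (by norm_num)
    rw [mul_sum]
    refine sum_le_sum fun y _ => ?_
    by_cases hxy : y = x
    · subst hxy
      simp
    · have h := (coverPiece_bounds hπ hP hProw hDB hA hcover hΘ hi hxy).1
      calc 1 / (Θ : ℝ) * (φ x * (mhKernel P φ : Matrix X X ℝ) x y * (f x - f y) ^ 2)
          = φ x * (1 / Θ * mhKernel P φ x y) * (f x - f y) ^ 2 := by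
            rw [show (mhKernel P φ : Matrix X X ℝ) x y = mhKernel P φ x y from rfl]; ring
        _ ≤ φ x * mhKernel (mhKernel P κ) φ x y * (f x - f y) ^ 2 :=
            mul_le_mul_of_nonneg_right (mul_le_mul_of_nonneg_left h (hφ0 x)) (sq_nonneg _)
  -- Poincaré with constant `Θ⁻¹ Gap(P[φ])`
  have hG0 : 0 ≤ spectralGapR φ (mhKernel P φ : Matrix X X ℝ) := spectralGapR_nonneg hφ0 hPφ0
  have hPoinc : ∀ f : X → ℝ, 1 / Θ * spectralGapR φ (mhKernel P φ : Matrix X X ℝ) * lawVariance φ f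
      ≤ dirichletForm φ (mhKernel (mhKernel P κ) φ : Matrix X X ℝ) f := by
    intro f
    have hgap : spectralGapR φ (mhKernel P φ : Matrix X X ℝ) * lawVariance φ f
        ≤ dirichletForm φ (mhKernel P φ : Matrix X X ℝ) f := by
      rcases (lawVariance_nonneg hφ0 f).eq_or_lt with hv | hv
      · rw [← hv, mul_zero]
        exact dirichletForm_nonneg hφ0 hPφ0 f
      · exact (le_div_iff₀ hv).mp (spectralGapR_le_dirichletForm_div_lawVariance hφ0 hφ1 hPφ0 hv)
    calc 1 / Θ * spectralGapR φ (mhKernel P φ : Matrix X X ℝ) * lawVariance φ f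
        = 1 / Θ * (spectralGapR φ (mhKernel P φ : Matrix X X ℝ) * lawVariance φ f) := by ring
      _ ≤ 1 / Θ * dirichletForm φ (mhKernel P φ : Matrix X X ℝ) f :=
          mul_le_mul_of_nonneg_left hgap (by positivity)
      _ ≤ _ := hE f
  by_cases hX : ∃ S : Finset X, 0 < ∑ x ∈ S, φ x ∧ ∑ x ∈ S, φ x ≤ 1 / 2
  · exact le_spectralGapR_of_poincare hφ1 hPoinc hX
  · obtain ⟨x₀, hz⟩ := exists_eq_zero_off_point hφ0 hφ1 hX
    rw [spectralGapR_eq_zero_of_eq_zero_off_point hφ1 hz, mul_zero]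
    exact spectralGapR_nonneg hφ0 hT0

/-! ## (5), (19)/(36)–(38): the crude chain `P_H` and the aggregated matrix `Q̄` -/

/-- **Eq. (5)**: the crude chain `P_H(a_i,a_j) = π[A_i ∩ A_j]/(Θ π[A_i])` (`i ≠ j`),
`P_H(a_i,a_i) = 1 − Σ_{j≠i} P_H(a_i,a_j)`, on the labels `{0,…,D}`. [cite: MadrasRandall2002, §1 eq. (5)] -/
noncomputable def coverChain (π : X → ℝ) (A : ℕ → Finset X) (D Θ : ℕ) :
    Matrix (Fin (D + 1)) (Fin (D + 1)) ℝ :=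
  of fun i j => if j = i then
      1 - ∑ k ∈ univ.erase i, pieceMass π (A i ∩ A k) / (Θ * pieceMass π (A i))
    else pieceMass π (A i ∩ A j) / (Θ * pieceMass π (A i))

/-- **Eqs. (19)/(36)**: the aggregated matrix `Q̄(i,j) = c_j Σ_x φ_i(x)φ_j(x)/κ(x)` of the simulated
tempering chain built from `c_i = π[A_i]/Z`, `φ_i`, `κ`. [cite: MadrasRandall2002, §2 eq. (19); §4
eq. (36)] -/
noncomputable def labelChain (π : X → ℝ) (A : ℕ → Finset X) (D : ℕ) :
    Matrix (Fin (D + 1)) (Fin (D + 1)) ℝ :=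
  of fun i j => pieceMass π (A j) / coverZ π A D
    * ∑ x, pieceLaw π (A i) x * pieceLaw π (A j) x / coverMixture π A D x

/-- **Eq. (36)**: `Q̄(i,j) = π[A_i]⁻¹ Σ_{x ∈ A_i ∩ A_j} π(x)/N(x)`. [cite: MadrasRandall2002, §4 eq. (36)] -/
theorem labelChain_apply {π : X → ℝ} (hπ : ∀ x, 0 < π x) {A : ℕ → Finset X} {D : ℕ}
    (hA : ∀ i ≤ D, 0 < pieceMass π (A i)) (hcover : ∀ x, ∃ i ≤ D, x ∈ A i) (i j : Fin (D + 1)) :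
    labelChain π A D i j
      = (∑ x ∈ A i ∩ A j, π x / coverCount A D x) / pieceMass π (A i) := by
  have hA' : ∀ k ≤ D, pieceMass π (A k) ≠ 0 := fun k hk => (hA k hk).ne'
  have hi : (i : ℕ) ≤ D := Nat.lt_succ_iff.mp i.isLt
  have hj : (j : ℕ) ≤ D := Nat.lt_succ_iff.mp j.isLt
  have hZ := coverZ_pos hA
  have hN : ∀ x, (0 : ℝ) < coverCount A D x := fun x => by exact_mod_cast one_le_coverCount hcover x
  unfold labelChain
  rw [of_apply, ← sum_filter_add_sum_filter_not univ (fun x => x ∈ A i ∩ A j)]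
  have hzero : ∑ x ∈ univ.filter (fun x => ¬ x ∈ A i ∩ A j),
      pieceLaw π (A i) x * pieceLaw π (A j) x / coverMixture π A D x = 0 := by
    refine sum_eq_zero fun x hx => ?_
    have hx := (mem_filter.mp hx).2
    rw [mem_inter, not_and_or] at hx
    unfold pieceLaw
    rcases hx with h | h
    · rw [if_neg h, zero_mul, zero_div]
    · simp only [if_neg h, mul_zero, zero_div]
  rw [hzero, add_zero, filter_mem_eq_inter, univ_inter, mul_sum, sum_div]
  refine sum_congr rfl fun x hx => ?_
  obtain ⟨hxi, hxj⟩ := mem_inter.mp hx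
  unfold pieceLaw
  rw [if_pos hxi, if_pos hxj, coverMixture_apply hA' x]
  unfold coverZ at *
  field_simp [(hπ x).ne', (hN x).ne', hZ.ne', hA' i hi, hA' j hj]

/-- **Eq. (37)**: `P_H(a_i,a_j) ≤ Q̄(i,j) ≤ Θ P_H(a_i,a_j)` for `i ≠ j` (since `1 ≤ N ≤ Θ` on a cover).
[cite: MadrasRandall2002, §4 eq. (37)] -/
theorem coverChain_le_labelChain {π : X → ℝ} (hπ : ∀ x, 0 < π x) {A : ℕ → Finset X} {D : ℕ}
    (hA : ∀ i ≤ D, 0 < pieceMass π (A i)) (hcover : ∀ x, ∃ i ≤ D, x ∈ A i) {Θ : ℕ}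
    (hΘ : ∀ x, coverCount A D x ≤ Θ) {i j : Fin (D + 1)} (hij : j ≠ i) :
    coverChain π A D Θ i j ≤ labelChain π A D i j ∧
      labelChain π A D i j ≤ Θ * coverChain π A D Θ i j := by
  have hi : (i : ℕ) ≤ D := Nat.lt_succ_iff.mp i.isLt
  have hMi := hA i hi
  have hN1 : ∀ x, (1 : ℝ) ≤ coverCount A D x := fun x => by exact_mod_cast one_le_coverCount hcover x
  have hNΘ : ∀ x, (coverCount A D x : ℝ) ≤ Θ := fun x => by exact_mod_cast hΘ x
  have hNpos : ∀ x, (0 : ℝ) < coverCount A D x := fun x => lt_of_lt_of_le one_pos (hN1 x)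
  obtain ⟨x₀, -⟩ := Finset.nonempty_of_sum_ne_zero hMi.ne'
  have hΘpos : (0 : ℝ) < Θ := lt_of_lt_of_le one_pos ((hN1 x₀).trans (hNΘ x₀))
  rw [labelChain_apply hπ hA hcover]
  unfold coverChain
  rw [of_apply, if_neg hij]
  have hm : pieceMass π (A i ∩ A j) = ∑ x ∈ A i ∩ A j, π x := rfl
  constructor
  · -- `π[A_i∩A_j]/(Θπ[A_i]) = (Σ π(x)/Θ)/π[A_i] ≤ (Σ π(x)/N(x))/π[A_i]`
    rw [← div_div]
    refine div_le_div_of_nonneg_right ?_ hMi.le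
    rw [hm, sum_div]
    exact sum_le_sum fun x _ => div_le_div_of_nonneg_left (hπ x).le (hNpos x) (hNΘ x)
  · -- `(Σ π/N)/π[A_i] ≤ π[A_i∩A_j]/π[A_i] = Θ · π[A_i∩A_j]/(Θπ[A_i])`
    rw [← mul_div_assoc, mul_div_mul_left _ _ hΘpos.ne']
    refine div_le_div_of_nonneg_right ?_ hMi.le
    rw [hm]
    exact sum_le_sum fun x _ => div_le_self (hπ x).le (hN1 x)

omit [Fintype X] in
/-- `Σ_k π[A_i ∩ A_k] = Σ_{x∈A_i} π(x)N(x) ≤ Θ π[A_i]`. [cite: MadrasRandall2002, §1 eqs. (3)–(5)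
(the row sums of `P_H`)] -/
theorem sum_pieceMass_inter_le {π : X → ℝ} (hπ : ∀ x, 0 ≤ π x) {A : ℕ → Finset X} {D Θ : ℕ}
    (hΘ : ∀ x, coverCount A D x ≤ Θ) (i : Fin (D + 1)) :
    ∑ k : Fin (D + 1), pieceMass π (A i ∩ A k) ≤ Θ * pieceMass π (A i) := by
  unfold pieceMass
  have h1 : ∀ k : Fin (D + 1), ∑ x ∈ A i ∩ A k, π x = ∑ x ∈ A i, if x ∈ A k then π x else 0 := by
    intro k
    rw [← filter_mem_eq_inter, sum_filter]
  simp_rw [h1]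
  rw [sum_comm, mul_sum]
  refine sum_le_sum fun x _ => ?_
  have hcount : ∑ k : Fin (D + 1), (if x ∈ A k then π x else 0) = π x * coverCount A D x := by
    have h2 : ∑ k : Fin (D + 1), (if x ∈ A k then π x else 0)
        = π x * ∑ k : Fin (D + 1), (if x ∈ A k then (1 : ℝ) else 0) := by
      rw [mul_sum]
      exact sum_congr rfl fun k _ => by split_ifs <;> simp
    rw [h2, Fin.sum_univ_eq_sum_range (fun k => if x ∈ A k then (1 : ℝ) else 0) (D + 1)]
    unfold coverCount
    rw [card_eq_sum_ones, Nat.cast_sum, sum_filter]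
    push_cast
    rfl
  rw [hcount, mul_comm]
  exact mul_le_mul_of_nonneg_right (by exact_mod_cast hΘ x) (hπ x)

omit [Fintype X] in
/-- `P_H ≥ 0` entrywise (the diagonal because `Σ_{j≠i} π[A_i∩A_j] ≤ Θπ[A_i]`).
[cite: MadrasRandall2002, §1 eq. (5)] -/
theorem coverChain_nonneg {π : X → ℝ} (hπ : ∀ x, 0 < π x) {A : ℕ → Finset X} {D : ℕ}
    (hA : ∀ i ≤ D, 0 < pieceMass π (A i)) (hcover : ∀ x, ∃ i ≤ D, x ∈ A i) {Θ : ℕ}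
    (hΘ : ∀ x, coverCount A D x ≤ Θ) (i j : Fin (D + 1)) : 0 ≤ coverChain π A D Θ i j := by
  have hi : (i : ℕ) ≤ D := Nat.lt_succ_iff.mp i.isLt
  have hMi := hA i hi
  obtain ⟨x₀, -⟩ := Finset.nonempty_of_sum_ne_zero hMi.ne'
  have hΘpos : (0 : ℝ) < Θ := by
    have h1 : (1 : ℝ) ≤ coverCount A D x₀ := by exact_mod_cast one_le_coverCount hcover x₀
    have h2 : (coverCount A D x₀ : ℝ) ≤ Θ := by exact_mod_cast hΘ x₀
    linarith
  unfold coverChain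
  rw [of_apply]
  split_ifs with h
  · rw [sub_nonneg, ← sum_div, div_le_one (mul_pos hΘpos hMi)]
    calc ∑ k ∈ univ.erase i, pieceMass π (A i ∩ A k)
        ≤ ∑ k : Fin (D + 1), pieceMass π (A i ∩ A k) :=
          sum_le_sum_of_subset_of_nonneg (erase_subset _ _) fun k _ _ =>
            sum_nonneg fun x _ => (hπ x).le
      _ ≤ Θ * pieceMass π (A i) := sum_pieceMass_inter_le (fun x => (hπ x).le) hΘ i
  · exact div_nonneg (sum_nonneg fun x _ => (hπ x).le) (mul_nonneg hΘpos.le hMi.le)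

/-- **Eq. (38), lower half**: `Gap(P_H) ≤ Gap(Q̄)` — both are reversible with respect to the weights
`c_i`, and `P_H ≤ Q̄` off the diagonal (Dirichlet-form monotonicity and the variational gap (7)).
[cite: MadrasRandall2002, §4 eq. (38)] -/
theorem MadrasRandall2002_eq_38 {π : X → ℝ} (hπ : ∀ x, 0 < π x) {A : ℕ → Finset X} {D : ℕ}
    (hA : ∀ i ≤ D, 0 < pieceMass π (A i)) (hcover : ∀ x, ∃ i ≤ D, x ∈ A i) {Θ : ℕ}
    (hΘ : ∀ x, coverCount A D x ≤ Θ) :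
    spectralGapR (fun i : Fin (D + 1) => pieceMass π (A i) / coverZ π A D) (coverChain π A D Θ)
      ≤ spectralGapR (fun i : Fin (D + 1) => pieceMass π (A i) / coverZ π A D) (labelChain π A D) := by
  have hZ := coverZ_pos hA
  have hc0 : ∀ i : Fin (D + 1), 0 ≤ pieceMass π (A i) / coverZ π A D := fun i =>
    div_nonneg (hA i (Nat.lt_succ_iff.mp i.isLt)).le hZ.le
  have hQ0 : ∀ i j, 0 ≤ labelChain π A D i j := by
    intro i j
    rw [labelChain_apply hπ hA hcover]
    exact div_nonneg (sum_nonneg fun x _ => div_nonneg (hπ x).le (Nat.cast_nonneg _))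
      (hA i (Nat.lt_succ_iff.mp i.isLt)).le
  exact spectralGapR_mono hc0 (coverChain_nonneg hπ hA hcover hΘ) fun u =>
    dirichletForm_mono hc0 (fun i j hij => (coverChain_le_labelChain hπ hA hcover hΘ
      (fun h => hij h.symm)).1) u

/-- **Proposition 3.2** with the probability-vector hypothesis only for the labels in use (`j ≤ D`)
— the form needed in §4, where `φ_j = π1_{A_j}/π[A_j]` is defined for the cover's indices only.
[cite: MadrasRandall2002, §3 Proposition 3.2; Appendix B] -/
theorem MadrasRandall2002_prop_3_2' {c : ℕ → ℝ} {φ : ℕ → X → ℝ} {D : ℕ} (hc : ∀ j ≤ D, 0 ≤ c j)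
    (hc1 : ∑ j ∈ range (D + 1), c j = 1) (hφ : ∀ j, ∀ x, 0 ≤ φ j x)
    (hφ1 : ∀ j ≤ D, ∑ x, φ j x = 1) {R : X → X → ℝ} (hR : ∀ x y, 0 ≤ R x y)
    (hRrow : ∀ x, ∑ y, R x y ≤ 1)
    (hX : ∃ S : Finset X, 0 < ∑ x ∈ S, mixture c φ D x ∧ ∑ x ∈ S, mixture c φ D x ≤ 1 / 2) :
    spectralGapR (temperingLaw c φ D) (temperingChain R c φ D)
      ≤ spectralGapR (mixture c φ D) (mhKernel R (mixture c φ D) : Matrix X X ℝ) := by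
  have hκ1 : ∑ x, mixture c φ D x = 1 := sum_mixture hc1 hφ1
  have hψ0 : ∀ p : X × Fin (D + 1), 0 ≤ temperingLaw c φ D p := fun p =>
    mul_nonneg (hc p.2 (Nat.lt_succ_iff.mp p.2.isLt)) (hφ p.2 p.1)
  have hM0 := temperingChain_nonneg hc hφ hR hRrow (D := D)
  obtain ⟨g₀, hg₀0, hg₀1⟩ := exists_mean_zero_piInner_one hκ1 hX
  refine le_csInf ⟨_, ⟨g₀, ⟨hg₀0, hg₀1⟩, rfl⟩⟩ ?_
  rintro _ ⟨g, ⟨hg0, hg1⟩, rfl⟩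
  have hf0 : ∑ p : X × Fin (D + 1), temperingLaw c φ D p * g p.1 = 0 := by
    rw [sum_temperingLaw_mul_comp_fst, hg0]
  have hf1 : piInner (temperingLaw c φ D) (fun p => g p.1) (fun p => g p.1) = 1 := by
    rw [piInner_temperingLaw_comp_fst, hg1]
  exact (spectralGapR_le_dirichletForm hψ0 hM0 hf0 hf1).trans
    (dirichletForm_temperingChain_comp_fst_le hc hφ hR hRrow g)

/-- `Q̄ ≥ 0` entrywise (`π > 0`). [cite: MadrasRandall2002, §4 eq. (36)] -/
theorem labelChain_nonneg {π : X → ℝ} (hπ : ∀ x, 0 < π x) {A : ℕ → Finset X} {D : ℕ}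
    (hA : ∀ i ≤ D, 0 < pieceMass π (A i)) (hcover : ∀ x, ∃ i ≤ D, x ∈ A i) (i j : Fin (D + 1)) :
    0 ≤ labelChain π A D i j := by
  rw [labelChain_apply hπ hA hcover]
  exact div_nonneg (sum_nonneg fun x _ => div_nonneg (hπ x).le (Nat.cast_nonneg _))
    (hA i (Nat.lt_succ_iff.mp i.isLt)).le

end Literature.Probability.MarkovChains.DensityDecomposition

/-! # PART C — the State Decomposition Theorem (Theorem 1.1):
# `Gap(P) ≥ Θ⁻¹ · Gap(P_H) · min{1, min_i Gap(P[A_i])}`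

This part ASSEMBLES eq. (39) of [MadrasRandall2002, §4] from `DensityDecomposition.lean` (the umbrella
density `κ` of an overlapping cover and eq. (31); Proposition 3.2 (Madras–Piccioni) with the
simulated-tempering chain `QPQ` on `Ω × {0,…,D}`), PART B (the crude chain `P_H` (5), the aggregated
matrix `Q̄` (19)/(36), eq. (38)) and PART A (Theorem 2.1 = Theorem A.1 of Caracciolo–Pelissetto–Sokal in
the projection case), after identifying the abstract objects of Theorem A.1 on `𝒮 = Ω × {0,…,D}` with pieces `𝒮_i = Ω × {i}`: `b = c` (`blockMass_temperingLaw`),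
`Q̄ = projectionChain ψ Q` (`projectionChain_temperingLabel`), `P̂ = P` for the block-diagonal `P = ⊕_i T_i`
(`restrictionChain_temperingMove`), and `Gap(P_i on 𝒮_i w.r.t. ψ_i) ≥ Gap(T_i on Ω w.r.t. φ_i)`
(`spectralGapR_piece_le_tempering`, test functions `f ↦ f(·, i)`).

THE CHAIN (39) AS TYPED [cite: MadrasRandall2002, §4 eq. (39)], for a `π`-reversible stochastic `P`
(`π > 0`) and a cover `A_0, …, A_D` (`D ≥ 1`) of multiplicity `≤ Θ`:
`Gap(P) ≥ Θ⁻¹ Gap(P[κ])` (31) `≥ Θ⁻¹ Gap(QPQ)` (Proposition 3.2 with `R = P`, `ρ = π`: the pieces are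
`T_i = P[φ_i] = P[A_i]`) `≥ Θ⁻¹ Gap(Q̄) · min{1, min_i Gap(T_i)}` (Theorem 2.1) `≥ Θ⁻¹ Gap(P_H) ·
min{1, min_i Gap(P[A_i])}` (38).  REMARK ON THE CONSTANT: the printed (8) has `Θ⁻²`; the printed (39)
takes its last step "by equations (38) and (35)", i.e. with the pieces `T_i = P[κ][φ_i]` of (32), which
costs the factor `Θ⁻¹` of (35).  With `R = P` in Proposition 3.2 — which is what the printed line
"(by Proposition 3.2 with `R = P` and `ρ = π`)" says, and is legitimate since Proposition 3.2 allows any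
reversible proposal — the pieces are `P[φ_i]` themselves and (35) is not needed, so the typed constant is
`Θ⁻¹` (times the `min{1, ·}` inherited from Theorem A.1's proof, immaterial for pieces with `Gap ≤ 1`).
The printed `Θ⁻²` statement follows a fortiori when `min_i Gap(P[A_i]) ≤ 1` (`MadrasRandall2002_thm_1_1`).
All gaps are the variational `Gap_R` of (7).  Also typed on the way: **THEOREM 2.1** for the concrete simulated
tempering chain of §2 (`MadrasRandall2002_thm_2_1`: `Gap(QPQ) ≥ Gap(Q̄)·min{1, min_i Gap(R[φ_i])}`).
Everything is PROVED (0 named facts).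
-/

namespace Literature.Probability.MarkovChains.DensityDecomposition

open Finset Matrix Literature.Probability.MarkovChains.Decomposition

variable {X : Type*} [Fintype X] [DecidableEq X]

/-! ## The abstract objects of Theorem A.1 on `Ω × {0,…,D}` with the label pieces -/

section identification

variable {c : ℕ → ℝ} {φ : ℕ → X → ℝ} {D : ℕ}

omit [DecidableEq X] in
/-- `b_i = ψ(Ω × {i}) = c_i` for probability vectors `φ_i`. [cite: MadrasRandall2002, §2 ("the marginal
probability of the label `i` is `c_i`"); Appendix A eq. (59)] -/
theorem blockMass_temperingLaw (hφ1 : ∀ j ≤ D, ∑ x, φ j x = 1) (i : Fin (D + 1)) :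
    blockMass (temperingLaw c φ D) Prod.snd i = c i := by
  unfold blockMass block
  rw [sum_filter, Fintype.sum_prod_type]
  simp only [temperingLaw]
  rw [show ∑ x, ∑ k : Fin (D + 1), (if ((x, k) : X × Fin (D + 1)).2 = i then c k * φ k x else 0)
      = ∑ x, c i * φ i x from sum_congr rfl fun x _ => by simp [Finset.sum_ite_eq']]
  rw [← mul_sum, hφ1 i (Nat.lt_succ_iff.mp i.isLt), mul_one]

omit [DecidableEq X] in
/-- `ψ_i(x,k) = 1_{k=i} φ_i(x)` (for `c_i ≠ 0`). [cite: MadrasRandall2002, Appendix A eq. (59) and the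
proof of Theorem 2.1 ("the measure `ψ_i(dx) … corresponds to `δ_i(j)φ_i(x)λ(dx)` on `𝒮_i = Ω × {i}`")] -/
theorem blockLaw_temperingLaw (hφ1 : ∀ j ≤ D, ∑ x, φ j x = 1) {i : Fin (D + 1)} (hc : c i ≠ 0)
    (p : X × Fin (D + 1)) :
    blockLaw (temperingLaw c φ D) Prod.snd i p = if p.2 = i then φ i p.1 else 0 := by
  unfold blockLaw
  rw [blockMass_temperingLaw hφ1 i]
  split_ifs with h
  · simp only [temperingLaw, h]
    rw [mul_div_cancel_left₀ _ hc]
  · rfl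

/-- `Q̄ = projectionChain ψ Q` on the label pieces is the aggregated matrix (19)/(62):
`Q̄(i,j) = c_j Σ_x φ_i(x)φ_j(x)/κ(x)`. [cite: MadrasRandall2002, §2 eq. (19); Appendix A eq. (62) and
the proof of Theorem 2.1 ("the operators `Q̄` defined by equations (19) and (62) are the same")] -/
theorem projectionChain_temperingLabel (hφ1 : ∀ j ≤ D, ∑ x, φ j x = 1) {i : Fin (D + 1)}
    (hc : c i ≠ 0) (j : Fin (D + 1)) :
    projectionChain (temperingLaw c φ D) (temperingLabel c φ D) Prod.snd i j
      = c j * ∑ x, φ i x * φ j x / mixture c φ D x := by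
  rw [projectionChain_apply, blockMass_temperingLaw hφ1 i]
  unfold blockFlow block
  rw [sum_filter, Fintype.sum_prod_type]
  have hinner : ∀ x (k : Fin (D + 1)),
      (∑ q ∈ univ.filter (fun q : X × Fin (D + 1) => q.2 = j),
        temperingLaw c φ D (x, k) * temperingLabel c φ D (x, k) q)
      = c k * φ k x * (c j * φ j x / mixture c φ D x) := by
    intro x k
    rw [sum_filter, Fintype.sum_prod_type]
    simp only [temperingLaw, temperingLabel, of_apply]
    rw [sum_eq_single x]
    · simp [Finset.sum_ite_eq']
    · intro y _ hy
      simp [hy]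
    · intro h; exact absurd (mem_univ _) h
  simp_rw [hinner]
  rw [show ∑ x, ∑ k : Fin (D + 1), (if ((x, k) : X × Fin (D + 1)).2 = i then
        c k * φ k x * (c j * φ j x / mixture c φ D x) else 0)
      = ∑ x, c i * φ i x * (c j * φ j x / mixture c φ D x) from
        sum_congr rfl fun x _ => by simp [Finset.sum_ite_eq']]
  rw [div_eq_iff hc, mul_sum, sum_mul]
  exact sum_congr rfl fun x _ => by ring

/-- `φ`-reversibility of `R[φ]` for `φ ≥ 0`, `R ≥ 0` (the edge weights `min{φ(x)R(x,y), φ(y)R(y,x)}`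
are symmetric). [cite: MadrasRandall2002, §1 ("It is easy to check that `R[ζ]` is reversible with
respect to `ζ`")] -/
theorem mhKernel_detailedBalance_of_nonneg {ζ : X → ℝ} (hζ : ∀ x, 0 ≤ ζ x) {R : X → X → ℝ}
    (hR : ∀ x y, 0 ≤ R x y) : DetailedBalance ζ (mhKernel R ζ) := by
  intro x y
  by_cases h : y = x
  · subst h; rfl
  · rw [mhKernel_of_ne h, mhKernel_of_ne (Ne.symm h), mul_mhRate_of_nonneg hζ hR,
      mul_mhRate_of_nonneg hζ hR, mhFlux_comm]

/-- `P = ⊕_i T_i` is stochastic. [cite: MadrasRandall2002, §2 eq. (15)] -/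
theorem temperingMove_isRowStochastic {R : X → X → ℝ} (hR : ∀ x y, 0 ≤ R x y)
    (hRrow : ∀ x, ∑ y, R x y ≤ 1) (hφ : ∀ j, ∀ x, 0 ≤ φ j x) :
    IsRowStochastic (temperingMove R φ D) := by
  refine ⟨fun p q => ?_, fun p => ?_⟩
  · simp only [temperingMove, of_apply]
    split_ifs
    · exact mhKernel_nonneg_of_nonneg (hφ _) hR hRrow _ _
    · exact le_rfl
  · rw [Fintype.sum_prod_type]
    simp only [temperingMove, of_apply]
    rw [sum_comm, Fintype.sum_eq_single p.2]
    · simp only [if_true]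
      exact mhKernel_sum_eq_one R (φ p.2) p.1
    · intro k hk
      simp [hk]

/-- `P = ⊕_i T_i` is `ψ`-reversible. [cite: MadrasRandall2002, §2 ("both `Q` and `P` are reversible
with respect to `ψ`")] -/
theorem temperingMove_detailedBalance {R : X → X → ℝ} (hR : ∀ x y, 0 ≤ R x y)
    (hφ : ∀ j, ∀ x, 0 ≤ φ j x) :
    DetailedBalance (temperingLaw c φ D) (temperingMove R φ D) := by
  intro p q
  simp only [temperingLaw, temperingMove, of_apply]
  by_cases h : q.2 = p.2
  · rw [if_pos h, if_pos h.symm, h]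
    have := mhKernel_detailedBalance_of_nonneg (hφ p.2) hR p.1 q.1
    calc c p.2 * φ p.2 p.1 * mhKernel R (φ p.2) p.1 q.1
        = c p.2 * (φ p.2 p.1 * mhKernel R (φ p.2) p.1 q.1) := by ring
      _ = c p.2 * (φ p.2 q.1 * mhKernel R (φ p.2) q.1 p.1) := by rw [this]
      _ = c p.2 * φ p.2 q.1 * mhKernel R (φ p.2) q.1 p.1 := by ring
  · rw [if_neg h, if_neg (fun h' => h h'.symm), mul_zero, mul_zero]

/-- `Q` is stochastic when `κ > 0`. [cite: MadrasRandall2002, §2 eq. (16)] -/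
theorem temperingLabel_isRowStochastic (hc : ∀ j ≤ D, 0 ≤ c j) (hφ : ∀ j, ∀ x, 0 ≤ φ j x)
    (hκ : ∀ x, 0 < mixture c φ D x) : IsRowStochastic (temperingLabel c φ D) := by
  refine ⟨fun p q => ?_, fun p => ?_⟩
  · simp only [temperingLabel, of_apply]
    split_ifs
    · exact div_nonneg (mul_nonneg (hc _ (Nat.lt_succ_iff.mp q.2.isLt)) (hφ _ _)) (hκ _).le
    · exact le_rfl
  · rw [Fintype.sum_prod_type]
    simp only [temperingLabel, of_apply]
    rw [sum_eq_single p.1]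
    · simp only [if_true]
      rw [← sum_div, sum_fin_weight_eq_mixture, div_self (hκ p.1).ne']
    · intro y _ hy
      simp [hy]
    · intro h; exact absurd (mem_univ _) h

omit [Fintype X] in
/-- `Q` is `ψ`-reversible. [cite: MadrasRandall2002, §2 ("One can check that both `Q` and `P` are
reversible with respect to `ψ`")] -/
theorem temperingLabel_detailedBalance :
    DetailedBalance (temperingLaw c φ D) (temperingLabel c φ D) := by
  intro p q
  simp only [temperingLaw, temperingLabel, of_apply]
  by_cases h : q.1 = p.1
  · rw [if_pos h, if_pos h.symm, h]
    ring
  · rw [if_neg h, if_neg (fun h' => h h'.symm), mul_zero, mul_zero]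

/-- `Q² = Q` (when `κ > 0`). [cite: MadrasRandall2002, §2 ("Observe that `Q² = Q`")] -/
theorem temperingLabel_mul_self (hκ : ∀ x, 0 < mixture c φ D x) :
    temperingLabel c φ D * temperingLabel c φ D = temperingLabel c φ D := by
  ext p q
  rw [mul_apply_sum, Fintype.sum_prod_type]
  simp only [temperingLabel, of_apply]
  rw [sum_eq_single p.1]
  · by_cases h : q.1 = p.1
    · simp only [if_true, h]
      rw [← sum_mul]
      simp_rw [← sum_div]
      rw [sum_fin_weight_eq_mixture, div_self (hκ p.1).ne', one_mul]
    · simp [h]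
  · intro y _ hy
    simp [hy]
  · intro h; exact absurd (mem_univ _) h

/-- `P̂ = P` for the block-diagonal `P = ⊕_i T_i` ("this kernel does not permit transitions from one
`𝒮_i` to another"). [cite: MadrasRandall2002, §2 eq. (15); Appendix A eqs. (57)–(58)] -/
theorem restrictionChain_temperingMove (R : X → X → ℝ) (φ : ℕ → X → ℝ) (D : ℕ) :
    restrictionChain (temperingMove R φ D) Prod.snd = temperingMove R φ D := by
  ext p q
  rw [restrictionChain_apply]
  by_cases hb : q.2 = p.2
  · rw [if_pos hb]
    by_cases hq : q = p
    · subst hq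
      rw [if_pos rfl]
      -- `1 − Σ_{z ∈ 𝒮_{p.2} ∖ {p}} P(p,z) = P(p,p)` since the block row sums to `1`
      have hrow : ∑ z ∈ block Prod.snd q.2, temperingMove R φ D q z = 1 := by
        unfold block
        rw [sum_filter, Fintype.sum_prod_type]
        simp only [temperingMove, of_apply]
        rw [sum_comm, Fintype.sum_eq_single q.2]
        · simp only [if_true]
          exact mhKernel_sum_eq_one R (φ q.2) q.1
        · intro k hk
          simp [hk]
      rw [← sum_erase_add _ _ (mem_block.mpr rfl)] at hrow
      linarith
    · rw [if_neg hq]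
  · rw [if_neg hb]
    simp only [temperingMove, of_apply, if_neg hb]

/-- **`Gap(T_i) ≤ Gap(P_i)`**: the piece `P_i` of Theorem A.1 on `𝒮_i = Ω × {i}` (with law `ψ_i`) has
variational gap at least that of `T_i` on `Ω` (with law `φ_i`) — every test function `f` on `𝒮`
admissible for `ψ_i` restricts to `f(·, i)` admissible for `φ_i` with the same Dirichlet form.
[cite: MadrasRandall2002, Appendix A, proof of Theorem 2.1 ("`P_i` and `b_i` of this appendix
respectively correspond to `T_i` and `c_i` of Section 2")] -/
theorem spectralGapR_piece_le_tempering {R : X → X → ℝ} (hR : ∀ x y, 0 ≤ R x y)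
    (hRrow : ∀ x, ∑ y, R x y ≤ 1) (hφ : ∀ j, ∀ x, 0 ≤ φ j x) (i : Fin (D + 1)) :
    spectralGapR (φ i) (mhKernel R (φ i) : Matrix X X ℝ)
      ≤ spectralGapR (fun p : X × Fin (D + 1) => if p.2 = i then φ i p.1 else 0)
          (temperingMove R φ D) := by
  set ψi : X × Fin (D + 1) → ℝ := fun p => if p.2 = i then φ i p.1 else 0 with hψi
  have hψi0 : ∀ p, 0 ≤ ψi p := fun p => by simp only [hψi]; split_ifs; exacts [hφ _ _, le_rfl]
  have hT0 : ∀ x y, 0 ≤ (mhKernel R (φ i) : Matrix X X ℝ) x y := fun x y =>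
    mhKernel_nonneg_of_nonneg (hφ i) hR hRrow x y
  -- restriction of test functions: sums against `ψ_i` only see the slice `k = i`
  have hslice : ∀ F : X × Fin (D + 1) → ℝ, ∑ p, ψi p * F p = ∑ x, φ i x * F (x, i) := by
    intro F
    rw [Fintype.sum_prod_type]
    refine sum_congr rfl fun x _ => ?_
    simp only [hψi]
    rw [Fintype.sum_eq_single i]
    · simp
    · intro k hk; simp [hk]
  have hE : ∀ f : X × Fin (D + 1) → ℝ, dirichletForm ψi (temperingMove R φ D) f
      = dirichletForm (φ i) (mhKernel R (φ i) : Matrix X X ℝ) (fun x => f (x, i)) := by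
    intro f
    unfold dirichletForm
    congr 1
    have : ∀ p : X × Fin (D + 1), ∑ q, ψi p * temperingMove R φ D p q * (f p - f q) ^ 2
        = ψi p * ∑ y, mhKernel R (φ p.2) p.1 y * (f p - f (y, p.2)) ^ 2 := by
      intro p
      rw [mul_sum, Fintype.sum_prod_type]
      refine sum_congr rfl fun y _ => ?_
      simp only [temperingMove, of_apply]
      rw [Fintype.sum_eq_single p.2]
      · simp only [if_true]; ring
      · intro k hk; simp [hk]
    simp_rw [this]
    rw [hslice]
    refine sum_congr rfl fun x _ => ?_
    rw [mul_sum]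
    exact sum_congr rfl fun y _ => by
      rw [show (mhKernel R (φ ↑i) : Matrix X X ℝ) x y = mhKernel R (φ i) x y from rfl]; ring
  by_cases hS : ({f : X × Fin (D + 1) → ℝ | ∑ p, ψi p * f p = 0 ∧ piInner ψi f f = 1}).Nonempty
  · refine le_csInf (hS.image _) ?_
    rintro _ ⟨f, ⟨hf0, hf1⟩, rfl⟩
    change spectralGapR (φ i) (mhKernel R (φ i) : Matrix X X ℝ) ≤ dirichletForm ψi (temperingMove R φ D) f
    rw [hE f]
    refine spectralGapR_le_dirichletForm (hφ i) hT0 ?_ ?_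
    · rw [← hf0, hslice]
    · unfold piInner at hf1 ⊢
      rw [← hf1, hslice]
  · -- no admissible `f` on `𝒮`: then none on `Ω` either (lift `g ↦ g ∘ fst`), both gaps are `sInf ∅`
    have hempty : ({g : X → ℝ | ∑ x, φ i x * g x = 0 ∧ piInner (φ i) g g = 1} : Set (X → ℝ)) = ∅ := by
      rw [Set.eq_empty_iff_forall_notMem]
      rintro g ⟨hg0, hg1⟩
      apply hS
      refine ⟨fun p => g p.1, ?_, ?_⟩
      · show ∑ p, ψi p * g p.1 = 0
        rw [hslice]; exact hg0
      · show piInner ψi (fun p => g p.1) (fun p => g p.1) = 1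
        unfold piInner at hg1 ⊢
        rw [hslice]; exact hg1
    rw [Set.not_nonempty_iff_eq_empty] at hS
    unfold spectralGapR
    rw [hempty, Set.image_empty, Real.sInf_empty]
    simp only [hψi] at hS
    rw [hS, Set.image_empty, Real.sInf_empty]

end identification

/-! ## Theorem 2.1 for the simulated tempering chain of §2 -/

/-- **THEOREM 2.1 (Caracciolo–Pelissetto–Sokal) for the simulated tempering chain `QPQ` of §2**
(eqs. (13)–(19)): with `T_i = R[φ_i]` the Metropolis–Hastings chains for a common proposal `R ≥ 0`
(row sums `≤ 1`), weights `c_i > 0` adding up to `1`, probability vectors `φ_i` with `κ = Σ c_iφ_i > 0`,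
and `Q̄(i,j) = c_j Σ_x φ_i(x)φ_j(x)/κ(x)` the aggregated matrix (19):
**`Gap(QPQ) ≥ Gap(Q̄) · min{1, min_i Gap(T_i)}`** (variational gaps; `D ≥ 1` labels `0,…,D`).
[cite: MadrasRandall2002, §2 Theorem 2.1 eq. (20); Appendix A (proof of Theorem 2.1 from Theorem A.1)] -/
theorem MadrasRandall2002_thm_2_1 {c : ℕ → ℝ} {φ : ℕ → X → ℝ} {D : ℕ} (hD : 1 ≤ D)
    (hc : ∀ j ≤ D, 0 < c j) (hc1 : ∑ j ∈ range (D + 1), c j = 1) (hφ0 : ∀ j, ∀ x, 0 ≤ φ j x)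
    (hφ1 : ∀ j ≤ D, ∑ x, φ j x = 1) {R : X → X → ℝ} (hR : ∀ x y, 0 ≤ R x y)
    (hRrow : ∀ x, ∑ y, R x y ≤ 1) (hκ : ∀ x, 0 < mixture c φ D x) :
    spectralGapR (fun i : Fin (D + 1) => c i)
          (Matrix.of fun i j : Fin (D + 1) => c j * ∑ x, φ i x * φ j x / mixture c φ D x)
        * min 1 (⨅ i : Fin (D + 1), spectralGapR (φ i) (mhKernel R (φ i) : Matrix X X ℝ))
      ≤ spectralGapR (temperingLaw c φ D) (temperingChain R c φ D) := by
  haveI : Nontrivial (Fin (D + 1)) := Fin.nontrivial_iff_two_le.mpr (by omega)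
  have hc0 : ∀ j ≤ D, 0 ≤ c j := fun j hj => (hc j hj).le
  have hψ0 : ∀ p : X × Fin (D + 1), 0 ≤ temperingLaw c φ D p := fun p =>
    mul_nonneg (hc0 p.2 (Nat.lt_succ_iff.mp p.2.isLt)) (hφ0 p.2 p.1)
  have hψ1 : ∑ p : X × Fin (D + 1), temperingLaw c φ D p = 1 := sum_temperingLaw hc1 hφ1
  have hPm : IsRowStochastic (temperingMove R φ D) := temperingMove_isRowStochastic hR hRrow hφ0
  have hPmDB : DetailedBalance (temperingLaw c φ D) (temperingMove R φ D) :=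
    temperingMove_detailedBalance hR hφ0
  have hQ : IsRowStochastic (temperingLabel c φ D) := temperingLabel_isRowStochastic hc0 hφ0 hκ
  have hQDB : DetailedBalance (temperingLaw c φ D) (temperingLabel c φ D) :=
    temperingLabel_detailedBalance
  have hQQ := temperingLabel_mul_self hκ (c := c) (φ := φ) (D := D)
  have hb : ∀ i : Fin (D + 1), blockMass (temperingLaw c φ D) Prod.snd i = c i :=
    blockMass_temperingLaw hφ1
  have hMpos : ∀ i : Fin (D + 1), 0 < blockMass (temperingLaw c φ D) Prod.snd i := fun i => by
    rw [hb i]; exact hc i (Nat.lt_succ_iff.mp i.isLt)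
  have hXψ : ∃ S : Finset (X × Fin (D + 1)), 0 < ∑ p ∈ S, temperingLaw c φ D p ∧
      ∑ p ∈ S, temperingLaw c φ D p ≤ 1 / 2 := by
    have h01 : c 0 + c 1 ≤ 1 := by
      rw [← hc1]
      calc c 0 + c 1 = ∑ j ∈ ({0, 1} : Finset ℕ), c j := by rw [sum_pair (by norm_num)]
        _ ≤ ∑ j ∈ range (D + 1), c j :=
            sum_le_sum_of_subset_of_nonneg (by
              intro j hj
              simp only [mem_insert, mem_singleton] at hj
              rw [mem_range]
              omega)
              fun j hj _ => hc0 j (Nat.lt_succ_iff.mp (mem_range.mp hj))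
    by_cases h : c 0 ≤ 1 / 2
    · refine ⟨block Prod.snd (0 : Fin (D + 1)), ?_⟩
      change 0 < blockMass (temperingLaw c φ D) Prod.snd 0 ∧
        blockMass (temperingLaw c φ D) Prod.snd 0 ≤ 1 / 2
      rw [hb]
      exact ⟨hc 0 (Nat.zero_le D), h⟩
    · refine ⟨block Prod.snd (⟨1, by omega⟩ : Fin (D + 1)), ?_⟩
      change 0 < blockMass (temperingLaw c φ D) Prod.snd ⟨1, by omega⟩ ∧
        blockMass (temperingLaw c φ D) Prod.snd ⟨1, by omega⟩ ≤ 1 / 2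
      rw [hb]
      refine ⟨hc 1 hD, ?_⟩
      change c 1 ≤ 1 / 2
      linarith
  have hCPS := MadrasRandall2002_thm_A_1_projection hψ0 hψ1 hPm hPmDB hQ hQDB hQQ hMpos hXψ
  have hchain : temperingLabel c φ D * temperingMove R φ D * temperingLabel c φ D
      = temperingChain R c φ D := rfl
  have hbfun : blockMass (temperingLaw c φ D) Prod.snd = fun i : Fin (D + 1) => c i := funext hb
  have hQbar : projectionChain (temperingLaw c φ D) (temperingLabel c φ D) Prod.snd
      = Matrix.of fun i j : Fin (D + 1) => c j * ∑ x, φ i x * φ j x / mixture c φ D x := by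
    ext i j
    rw [projectionChain_temperingLabel hφ1 (hc i (Nat.lt_succ_iff.mp i.isLt)).ne' j, of_apply]
  have hrestr := restrictionChain_temperingMove R φ D
  have hlaw : ∀ i : Fin (D + 1), blockLaw (temperingLaw c φ D) Prod.snd i
      = fun p => if p.2 = i then φ i p.1 else 0 := fun i =>
    funext fun p => blockLaw_temperingLaw hφ1 (hc i (Nat.lt_succ_iff.mp i.isLt)).ne' p
  rw [hchain, hbfun, hQbar, hrestr] at hCPS
  simp_rw [hlaw] at hCPS
  have hmm' : (⨅ i : Fin (D + 1), spectralGapR (φ i) (mhKernel R (φ i) : Matrix X X ℝ))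
      ≤ ⨅ i : Fin (D + 1), spectralGapR (fun p : X × Fin (D + 1) => if p.2 = i then φ i p.1 else 0)
          (temperingMove R φ D) :=
    le_ciInf fun i => (ciInf_le (Set.finite_range _).bddBelow i).trans
      (spectralGapR_piece_le_tempering hR hRrow hφ0 i)
  have hQbar0 : 0 ≤ spectralGapR (fun i : Fin (D + 1) => c i)
      (Matrix.of fun i j : Fin (D + 1) => c j * ∑ x, φ i x * φ j x / mixture c φ D x) :=
    spectralGapR_nonneg (fun i : Fin (D + 1) => hc0 i.1 (Nat.lt_succ_iff.mp i.isLt)) fun i j => by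
      rw [of_apply]
      exact mul_nonneg (hc0 j.1 (Nat.lt_succ_iff.mp j.isLt)) (sum_nonneg fun x _ =>
        div_nonneg (mul_nonneg (hφ0 _ x) (hφ0 _ x)) (hκ x).le)
  exact (mul_le_mul_of_nonneg_left (min_le_min_left 1 hmm') hQbar0).trans hCPS

/-! ## Theorem 1.1 -/

/-- **THEOREM 1.1 (State Decomposition Theorem)**, typed form: for a `π`-reversible stochastic `P`
(`π > 0`, `|Ω| ≥ 2`) and subsets `A_0, …, A_D` (`D ≥ 1`) covering `Ω`, each of positive `π`-mass and
each point lying in at most `Θ` of them, with `P_H` the crude chain (5) on the weights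
`c_i = π[A_i]/Z` and `P[A_i] = P[φ_i]` the restrictions (1):
**`Gap(P) ≥ Θ⁻¹ · Gap(P_H) · min{1, min_i Gap(P[A_i])}`** (all gaps variational, eq. (7)).
[cite: MadrasRandall2002, §1 Theorem 1.1 eq. (8); §4 eq. (39) (its proof)] -/
theorem MadrasRandall2002_thm_1_1_typed [Nontrivial X] {π : X → ℝ} (hπ : ∀ x, 0 < π x)
    (hπ1 : ∑ x, π x = 1) {P : X → X → ℝ} (hP : ∀ x y, 0 ≤ P x y) (hrow : ∀ x, ∑ y, P x y = 1)
    (hDB : DetailedBalance π P) {A : ℕ → Finset X} {D : ℕ} (hD : 1 ≤ D)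
    (hA : ∀ i ≤ D, 0 < pieceMass π (A i)) (hcover : ∀ x, ∃ i ≤ D, x ∈ A i) {Θ : ℕ}
    (hΘ : ∀ x, coverCount A D x ≤ Θ) :
    1 / Θ * spectralGapR (fun i : Fin (D + 1) => pieceMass π (A i) / coverZ π A D) (coverChain π A D Θ)
        * min 1 (⨅ i : Fin (D + 1), spectralGapR (pieceLaw π (A i))
            (mhKernel P (pieceLaw π (A i)) : Matrix X X ℝ))
      ≤ spectralGapR π (P : Matrix X X ℝ) := by
  haveI : Nontrivial (Fin (D + 1)) := Fin.nontrivial_iff_two_le.mpr (by omega)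
  -- the cast of characters
  set c : ℕ → ℝ := fun i => pieceMass π (A i) / coverZ π A D with hc
  set φ : ℕ → X → ℝ := fun i => pieceLaw π (A i) with hφ
  set κ := coverMixture π A D with hκ
  have hκmix : κ = mixture c φ D := rfl
  have hπ0 : ∀ x, 0 ≤ π x := fun x => (hπ x).le
  have hA' : ∀ i ≤ D, pieceMass π (A i) ≠ 0 := fun i hi => (hA i hi).ne'
  have hZ : 0 < coverZ π A D := coverZ_pos hA
  have hc0 : ∀ j ≤ D, 0 ≤ c j := fun j hj => div_nonneg (hA j hj).le hZ.le
  have hcpos : ∀ j ≤ D, 0 < c j := fun j hj => div_pos (hA j hj) hZ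
  have hc1 : ∑ j ∈ range (D + 1), c j = 1 := by
    simp only [hc]
    rw [← sum_div]
    exact div_self hZ.ne'
  have hφ0 : ∀ j, ∀ x, 0 ≤ φ j x := fun j => pieceLaw_nonneg hπ0 (A j)
  have hφ1 : ∀ j ≤ D, ∑ x, φ j x = 1 := fun j hj => sum_pieceLaw (hA' j hj)
  have hN1 : ∀ x, (1 : ℝ) ≤ coverCount A D x := fun x => by exact_mod_cast one_le_coverCount hcover x
  have hκpos : ∀ x, 0 < κ x := fun x => by
    rw [hκ, coverMixture_apply hA' x]
    exact div_pos (mul_pos (hπ x) (lt_of_lt_of_le one_pos (hN1 x))) hZ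
  have hκpos' : ∀ x, 0 < mixture c φ D x := hκpos
  have hProw : ∀ x, ∑ y, P x y ≤ 1 := fun x => (hrow x).le
  obtain ⟨x₀, x₁, hne⟩ := exists_pair_ne X
  have hΘpos : (0 : ℝ) < Θ := lt_of_lt_of_le one_pos ((hN1 x₀).trans (by exact_mod_cast hΘ x₀))
  -- STEP (31): `Gap(P[κ]) ≤ Θ Gap(P)`
  have h31 := (MadrasRandall2002_eq_31 hπ hπ1 hP hrow hDB hA hcover hΘ).2
  change spectralGapR κ (mhKernel P κ : Matrix X X ℝ) ≤ Θ * spectralGapR π (P : Matrix X X ℝ) at h31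
  -- STEP Prop. 3.2 with `R = P`: `Gap_R(ψ, QPQ) ≤ Gap(P[κ])`, `κ` not a point mass (`κ > 0`, `|Ω| ≥ 2`)
  have hXκ : ∃ S : Finset X, 0 < ∑ x ∈ S, mixture c φ D x ∧ ∑ x ∈ S, mixture c φ D x ≤ 1 / 2 := by
    have hκ1 : ∑ x, mixture c φ D x = 1 := sum_mixture hc1 hφ1
    by_cases h : mixture c φ D x₀ ≤ 1 / 2
    · exact ⟨{x₀}, by rw [sum_singleton]; exact ⟨hκpos' x₀, h⟩⟩
    · refine ⟨{x₁}, ?_⟩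
      rw [sum_singleton]
      refine ⟨hκpos' x₁, ?_⟩
      have hle : mixture c φ D x₀ + mixture c φ D x₁ ≤ ∑ x, mixture c φ D x := by
        rw [← sum_pair hne]
        exact sum_le_sum_of_subset_of_nonneg (subset_univ _) fun x _ _ => (hκpos' x).le
      linarith
  have h32 := MadrasRandall2002_prop_3_2' hc0 hc1 hφ0 hφ1 hP hProw hXκ
  -- STEP Theorem 2.1 / A.1 on `𝒮 = Ω × {0,…,D}` with the label pieces
  have hψ0 : ∀ p : X × Fin (D + 1), 0 ≤ temperingLaw c φ D p := fun p =>
    mul_nonneg (hc0 p.2 (Nat.lt_succ_iff.mp p.2.isLt)) (hφ0 p.2 p.1)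
  have hψ1 : ∑ p : X × Fin (D + 1), temperingLaw c φ D p = 1 := sum_temperingLaw hc1 hφ1
  have hPm : IsRowStochastic (temperingMove P φ D) := temperingMove_isRowStochastic hP hProw hφ0
  have hPmDB : DetailedBalance (temperingLaw c φ D) (temperingMove P φ D) :=
    temperingMove_detailedBalance hP hφ0
  have hQ : IsRowStochastic (temperingLabel c φ D) := temperingLabel_isRowStochastic hc0 hφ0 hκpos'
  have hQDB : DetailedBalance (temperingLaw c φ D) (temperingLabel c φ D) :=
    temperingLabel_detailedBalance
  have hQQ := temperingLabel_mul_self hκpos' (c := c) (φ := φ) (D := D)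
  have hb : ∀ i : Fin (D + 1), blockMass (temperingLaw c φ D) Prod.snd i = c i :=
    blockMass_temperingLaw hφ1
  have hMpos : ∀ i : Fin (D + 1), 0 < blockMass (temperingLaw c φ D) Prod.snd i := fun i => by
    rw [hb i]; exact hcpos i (Nat.lt_succ_iff.mp i.isLt)
  have hXψ : ∃ S : Finset (X × Fin (D + 1)), 0 < ∑ p ∈ S, temperingLaw c φ D p ∧
      ∑ p ∈ S, temperingLaw c φ D p ≤ 1 / 2 := by
    have h01 : c 0 + c 1 ≤ 1 := by
      rw [← hc1]
      calc c 0 + c 1 = ∑ j ∈ ({0, 1} : Finset ℕ), c j := by rw [sum_pair (by norm_num)]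
        _ ≤ ∑ j ∈ range (D + 1), c j :=
            sum_le_sum_of_subset_of_nonneg (by
              intro j hj
              simp only [mem_insert, mem_singleton] at hj
              rw [mem_range]
              omega)
              fun j hj _ => hc0 j (Nat.lt_succ_iff.mp (mem_range.mp hj))
    by_cases h : c 0 ≤ 1 / 2
    · refine ⟨block Prod.snd (0 : Fin (D + 1)), ?_⟩
      change 0 < blockMass (temperingLaw c φ D) Prod.snd 0 ∧
        blockMass (temperingLaw c φ D) Prod.snd 0 ≤ 1 / 2
      rw [hb]
      exact ⟨hcpos 0 (Nat.zero_le D), h⟩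
    · refine ⟨block Prod.snd (⟨1, by omega⟩ : Fin (D + 1)), ?_⟩
      change 0 < blockMass (temperingLaw c φ D) Prod.snd ⟨1, by omega⟩ ∧
        blockMass (temperingLaw c φ D) Prod.snd ⟨1, by omega⟩ ≤ 1 / 2
      rw [hb]
      refine ⟨hcpos 1 hD, ?_⟩
      change c 1 ≤ 1 / 2
      linarith
  have hCPS := MadrasRandall2002_thm_A_1_projection hψ0 hψ1 hPm hPmDB hQ hQDB hQQ hMpos hXψ
  -- identify: `Q P Q = temperingChain`, `b = c`, `Q̄ = labelChain`, `P̂ = P`, `ψ_i`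
  have hchain : temperingLabel c φ D * temperingMove P φ D * temperingLabel c φ D
      = temperingChain P c φ D := rfl
  have hbfun : blockMass (temperingLaw c φ D) Prod.snd
      = fun i : Fin (D + 1) => pieceMass π (A i) / coverZ π A D := funext hb
  have hQbar : projectionChain (temperingLaw c φ D) (temperingLabel c φ D) Prod.snd
      = labelChain π A D := by
    ext i j
    rw [projectionChain_temperingLabel hφ1 (hcpos i (Nat.lt_succ_iff.mp i.isLt)).ne' j]
    rfl
  have hrestr := restrictionChain_temperingMove P φ D
  have hlaw : ∀ i : Fin (D + 1), blockLaw (temperingLaw c φ D) Prod.snd i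
      = fun p => if p.2 = i then φ i p.1 else 0 := fun i =>
    funext fun p => blockLaw_temperingLaw hφ1 (hcpos i (Nat.lt_succ_iff.mp i.isLt)).ne' p
  rw [hchain, hbfun, hQbar, hrestr] at hCPS
  simp_rw [hlaw] at hCPS
  -- the pieces: `Gap(P[φ_i]) ≤ Gap(P_i on 𝒮_i)`
  set m := ⨅ i : Fin (D + 1), spectralGapR (pieceLaw π (A i))
    (mhKernel P (pieceLaw π (A i)) : Matrix X X ℝ) with hm
  set m' := ⨅ i : Fin (D + 1), spectralGapR (fun p : X × Fin (D + 1) => if p.2 = i then φ i p.1 else 0)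
    (temperingMove P φ D) with hm'
  have hmm' : m ≤ m' :=
    le_ciInf fun i => (ciInf_le (Set.finite_range _).bddBelow i).trans
      (spectralGapR_piece_le_tempering hP hProw hφ0 i)
  have hm0 : 0 ≤ m := le_ciInf fun i => spectralGapR_nonneg (hφ0 i)
    fun x y => mhKernel_nonneg_of_nonneg (hφ0 i) hP hProw x y
  -- STEP (38)
  have h38 := MadrasRandall2002_eq_38 hπ hA hcover hΘ
  have hQbar0 : 0 ≤ spectralGapR (fun i : Fin (D + 1) => pieceMass π (A i) / coverZ π A D)
      (labelChain π A D) :=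
    spectralGapR_nonneg (fun i : Fin (D + 1) => hc0 i.1 (Nat.lt_succ_iff.mp i.isLt))
      (labelChain_nonneg hπ hA hcover)
  -- assemble (39)
  have hmin : min 1 m ≤ min 1 m' := min_le_min_left 1 hmm'
  have hmin0 : 0 ≤ min 1 m := le_min zero_le_one hm0
  calc 1 / Θ * spectralGapR (fun i : Fin (D + 1) => pieceMass π (A i) / coverZ π A D)
          (coverChain π A D Θ) * min 1 m
      ≤ 1 / Θ * spectralGapR (fun i : Fin (D + 1) => pieceMass π (A i) / coverZ π A D)
          (labelChain π A D) * min 1 m' :=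
        mul_le_mul (mul_le_mul_of_nonneg_left h38 (by positivity)) hmin hmin0
          (mul_nonneg (by positivity) hQbar0)
    _ ≤ 1 / Θ * spectralGapR (temperingLaw c φ D) (temperingChain P c φ D) := by
        rw [mul_assoc]
        exact mul_le_mul_of_nonneg_left hCPS (by positivity)
    _ ≤ 1 / Θ * spectralGapR κ (mhKernel P κ : Matrix X X ℝ) :=
        mul_le_mul_of_nonneg_left h32 (by positivity)
    _ ≤ 1 / Θ * (Θ * spectralGapR π (P : Matrix X X ℝ)) :=
        mul_le_mul_of_nonneg_left h31 (by positivity)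
    _ = spectralGapR π (P : Matrix X X ℝ) := by
        field_simp

/-- **THEOREM 1.1 (State Decomposition Theorem) as printed**: `Gap(P) ≥ Θ⁻² Gap(P_H) min_i Gap(P[A_i])`
— here from the typed `Θ⁻¹` bound, for pieces with `min_i Gap(P[A_i]) ≤ 1` (as for every lazy or
Metropolis-type restriction; `Θ ≥ 1`). [cite: MadrasRandall2002, §1 Theorem 1.1 eq. (8)] -/
theorem MadrasRandall2002_thm_1_1 [Nontrivial X] {π : X → ℝ} (hπ : ∀ x, 0 < π x)
    (hπ1 : ∑ x, π x = 1) {P : X → X → ℝ} (hP : ∀ x y, 0 ≤ P x y) (hrow : ∀ x, ∑ y, P x y = 1)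
    (hDB : DetailedBalance π P) {A : ℕ → Finset X} {D : ℕ} (hD : 1 ≤ D)
    (hA : ∀ i ≤ D, 0 < pieceMass π (A i)) (hcover : ∀ x, ∃ i ≤ D, x ∈ A i) {Θ : ℕ}
    (hΘ : ∀ x, coverCount A D x ≤ Θ)
    (hgap1 : ⨅ i : Fin (D + 1), spectralGapR (pieceLaw π (A i))
      (mhKernel P (pieceLaw π (A i)) : Matrix X X ℝ) ≤ 1) :
    1 / Θ ^ 2 * spectralGapR (fun i : Fin (D + 1) => pieceMass π (A i) / coverZ π A D)
          (coverChain π A D Θ)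
        * (⨅ i : Fin (D + 1), spectralGapR (pieceLaw π (A i))
            (mhKernel P (pieceLaw π (A i)) : Matrix X X ℝ))
      ≤ spectralGapR π (P : Matrix X X ℝ) := by
  have h := MadrasRandall2002_thm_1_1_typed hπ hπ1 hP hrow hDB hD hA hcover hΘ
  rw [min_eq_right hgap1] at h
  have hZ := coverZ_pos hA
  have hN1 : (1 : ℝ) ≤ coverCount A D (Classical.arbitrary X) := by
    exact_mod_cast one_le_coverCount hcover _
  have hΘ1 : (1 : ℝ) ≤ Θ := hN1.trans (by exact_mod_cast hΘ _)
  have hG0 : 0 ≤ spectralGapR (fun i : Fin (D + 1) => pieceMass π (A i) / coverZ π A D)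
      (coverChain π A D Θ) :=
    spectralGapR_nonneg (fun i : Fin (D + 1) => div_nonneg (hA i.1 (Nat.lt_succ_iff.mp i.isLt)).le hZ.le)
      (coverChain_nonneg hπ hA hcover hΘ)
  have hm0 : 0 ≤ ⨅ i : Fin (D + 1), spectralGapR (pieceLaw π (A i))
      (mhKernel P (pieceLaw π (A i)) : Matrix X X ℝ) :=
    le_ciInf fun i => spectralGapR_nonneg (pieceLaw_nonneg (fun x => (hπ x).le) (A i))
      fun x y => mhKernel_nonneg_of_nonneg (pieceLaw_nonneg (fun x => (hπ x).le) (A i)) hP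
        (fun x => (hrow x).le) x y
  -- `Θ⁻² ≤ Θ⁻¹`
  have hinv : 1 / (Θ : ℝ) ^ 2 ≤ 1 / Θ := by
    rw [div_le_div_iff₀ (by positivity) (by positivity)]
    nlinarith
  calc 1 / (Θ : ℝ) ^ 2 * spectralGapR (fun i : Fin (D + 1) => pieceMass π (A i) / coverZ π A D)
          (coverChain π A D Θ) * (⨅ i : Fin (D + 1), spectralGapR (pieceLaw π (A i))
            (mhKernel P (pieceLaw π (A i)) : Matrix X X ℝ))
      ≤ 1 / Θ * spectralGapR (fun i : Fin (D + 1) => pieceMass π (A i) / coverZ π A D)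
          (coverChain π A D Θ) * (⨅ i : Fin (D + 1), spectralGapR (pieceLaw π (A i))
            (mhKernel P (pieceLaw π (A i)) : Matrix X X ℝ)) :=
        mul_le_mul_of_nonneg_right (mul_le_mul_of_nonneg_right hinv hG0) hm0
    _ ≤ _ := h

end Literature.Probability.MarkovChains.DensityDecomposition
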